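import Literature.MathematicalPhysics.QuantumFieldTheory.Balaban1983to89.B9Thm34GFinalBlk
import Literature.MathematicalPhysics.QuantumFieldTheory.Balaban1983to89.B9Ineq385KernelConcrete

/-!
# `Balaban1983to89.B9Thm34GKernelBlk` — [Balaban1985BackgroundPropagators] THEOREM 3.4 p. 400, `G`-CLAUSE, WITH THE ENTRIES (3.42) OF `G(U′U)` IN
# THE PRINTED KERNEL FORM `|G(U′U)(x,x′)| ≦ B′(Lʲη)²(L^{j′}η)^{−d}e^{−(δ₀/10)d(y,y′)}`, …, THE THEOREM 3.2 LETTERS `Q′(U), Q′*(U), C⁻¹` ON A GENERAL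
# FINITE BLOCK CARRIER `(P, blkP, rep)` — the append-only twin of r06's FILE 24 `B9Thm34GKernel` (`thm34_G_kernelEntries`,
# `thm34_G_kernelEntriesAll`): FILE K0 `B9Thm34GFinalBlk.thm34_G_clause_final_blk` used BY NAME plus the kernel step of FILES 21–23 («This way
# we get all these inequalities for the operator G(U′U), the local ones follow from the bound (3.85) and Lemma 2.1 [4]», p. 407) — R-Ker-5
# file K1 of the `lit-balaban` r06 Blk series (consumer lineage `pub-ymgap` dag-n06-c: the G-kernel / `L²` frames V3 at `node00-def-Y`'s
# letters, coarse carrier `BlkY × ι`)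

statement-level skeleton of published theorems with citation tags; proofs where landed; nothing here is a claim about the Yang–Mills mass gap

CITATION HEADER (lean-in-tree rule).  B9 = T. Bałaban, *Propagators for lattice gauge theories in a background field*, Commun. Math. Phys.
**99** (1985) 389–434 [Balaban1985BackgroundPropagators] (held `paper:balaban1985-cmp99-background-propagators`; journal page = PDF page + 388):
Theorem 3.4 p. 400 [PDF 12] l. 7–10; Theorem 3.1 (3.42) p. 397 in the printed KERNEL shape «|G′(U)(x,x′)| ≦ B₀(Lʲη)²(L^{j′}η)^{−d}e^{−δ₀d(y,y′)} for
x ∈ Δ(y), y ∈ Λ_j, x′ ∈ Δ(y′)» (`B6RandomWalkKernel.HasKernelBound`, pairing `c = η^d`, volume `v(y′) = (L^{j′}η)^d`, p. 393); Theorem 3.3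
p. 399; (3.76)–(3.77) pp. 405–406; (3.82)–(3.86) p. 407 with p. 407 l. −3…−1 («the local ones follow from the bound (3.85) and Lemma 2.1 [4]»);
Thm 3.2 (3.48) p. 398; (3.19) p. 393, (3.21)/(3.25) p. 394; (3.57) p. 401, (3.58)–(3.65) p. 402.  [4] = [Balaban1984PropagatorsII] Lemma 2.1
(2.61) p. 234, (2.51)–(2.55) p. 232, (2.66) p. 234.  Cell `lit-balaban`, seat r06 gen 68; rows B9.Thm3.4 × B9.Thm3.3 × B9.Eq3.85 (cells only).

WHAT THIS FILE PROVES (two theorems; 0 `def`; 0 sorry; standard axioms).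
* **`thm34_G_kernelEntries_blk`**, **`thm34_G_kernelEntriesAll_blk`** — FILE 24's `thm34_G_kernelEntries` / `thm34_G_kernelEntriesAll`
  VERBATIM (same constants `B′ = B₀ + B·κ₃₈₅(…)α₁·c₁(1/100)`, same rates `δ₀/6`, `δ₀/10`, same (3.77) hypothesis shape for the concrete
  `P₁(A)` read through the section) except that the block carrier of the `C`-letters is a general finite type: binders `{P : Type} [Fintype P]
  [DecidableEq P] (blkP : P → g.Site) (rep : P → S × ι) (hrep : ∀ p, blk (rep p).1 = blkP p) (hinj : Function.Injective rep)`, letters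
  `Qc Qc' Fc : (S × ι → ℝ) →ₗ[ℝ] (P → ℝ)`, `Qcs Qcs' Fcs : (P → ℝ) →ₗ[ℝ] (S × ι → ℝ)`, `Linv Tinv : Module.End ℝ (P → ℝ)`, and Theorem
  3.2's (3.48) for `U` as the [4] (2.51) block majorant `HasMajorant blkP Linv (B₁·(Lʲη)^{−4}·e^{−δ₀d})`.  The scalar statements are the case
  `P = 𝔅`, `blkP = id`, `rep` = FILE 17's section.

PROOF.  FILE 24's proofs verbatim, with the callee `B9Thm34GFinalBlk.thm34_G_clause_final_blk` (K0) in place of FILE 20; the kernel devices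
`B9Ineq385KernelConcrete.ineq385_kernel_concreteV₃`, `gExt_kernelEntry_of_386`, `eq376_concrete`, the FILE 17 section letters `secRes`,
`secExt`, `secConj` (typed for any section) are USED BY NAME unchanged.

HONEST SCOPE / NOT CLAIMED.  As FILE 24 (its module docstring applies verbatim).  Re-typing only: no new mathematics, no new named fact, nothing
about continuum / OS / mass gap / Clay; N06 of `pub-ymgap` is NOT discharged by this file.

RELATED IN THE TREE, NOT DUPLICATED: FILE 24 `B9Thm34GKernel` (scalar carrier), K0 `B9Thm34GFinalBlk`, FILES 21–23 (`B9Ineq385Kernel*`) — USED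
BY NAME; next in the cone: `B9Thm34GKernelFinal` §3/§4, `B9Thm34GKernelUniform` §1/§3, `B9Ineq346L2Uniform` §2 twins.
-/

noncomputable section

namespace Literature.MathematicalPhysics.QuantumFieldTheory.Balaban1983to89.B9Thm34GKernelBlk

open NormedSpace Complex
open Literature.MathematicalPhysics.QuantumFieldTheory.Balaban1983to89
open Literature.MathematicalPhysics.QuantumFieldTheory.Balaban1983to89.B6RandomWalk (HasMajorant hasMajorant_mono Triangle254 Ineq261)
open Literature.MathematicalPhysics.QuantumFieldTheory.Balaban1983to89.B6RandomWalkHom (HasMajorantHom)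
open Literature.MathematicalPhysics.QuantumFieldTheory.Balaban1983to89.B6RandomWalkKernel (ker HasKernelBound hasKernelBound_mono)
open Literature.MathematicalPhysics.QuantumFieldTheory.Balaban1983to89.B9Thm34Ext (toB6)
open Literature.MathematicalPhysics.QuantumFieldTheory.Balaban1983to89.B9Ineq347 (ScaleTransfer)
open Literature.MathematicalPhysics.QuantumFieldTheory.Balaban1983to89.B9Eq386Neumann (pTwo deltaA vTotal vThree eq384_sub)
open Literature.MathematicalPhysics.QuantumFieldTheory.Balaban1983to89.B9Ineq385VG (kappa383 kappa383_nonneg kappa385 kappa385_nonneg ineq383_op)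
open Literature.MathematicalPhysics.QuantumFieldTheory.Balaban1983to89.B9Eq39Adjoint
open Literature.MathematicalPhysics.QuantumFieldTheory.Balaban1983to89.B9Eq369Small (Through)
open Literature.MathematicalPhysics.QuantumFieldTheory.Balaban1983to89.B9Eq372Locality (stBonds)
open Literature.MathematicalPhysics.QuantumFieldTheory.Balaban1983to89.B9Eq352DivForm (tauF tauB)
open Literature.MathematicalPhysics.QuantumFieldTheory.Balaban1983to89.B9Eq352DivFormLetters
open Literature.MathematicalPhysics.QuantumFieldTheory.Balaban1983to89.B9Eq352GradLetters (diffLetter)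
open Literature.MathematicalPhysics.QuantumFieldTheory.Balaban1983to89.B9Eq371GradLetters (bT bU)
open Literature.MathematicalPhysics.QuantumFieldTheory.Balaban1983to89.B9Eq372RemLetters (lapDDLetter V₁Op V₂Op conj_lapDDLetter_prodCfg)
open Literature.MathematicalPhysics.QuantumFieldTheory.Balaban1983to89.B9Eq382V3Letters (dPrimeLetter V₃Op conj_V₃Op_eq_vThree)
open Literature.MathematicalPhysics.QuantumFieldTheory.Balaban1983to89.B9Eq376POneLetters (conjHom gradLin divLin eq376_concrete)
open Literature.MathematicalPhysics.QuantumFieldTheory.Balaban1983to89.B9Ineq385V3Concrete (cV385 cV385_nonneg)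
open Literature.MathematicalPhysics.QuantumFieldTheory.Balaban1983to89.B9Eq360Vprime (gPrimeExtEnd)
open Literature.MathematicalPhysics.QuantumFieldTheory.Balaban1983to89.B9Eq360VprimeLetters (vPrimeConc)
open Literature.MathematicalPhysics.QuantumFieldTheory.Balaban1983to89.B6RandomWalkSection (secExt secRes secConj)
open Literature.MathematicalPhysics.QuantumFieldTheory.Balaban1983to89.B9Thm34GFinalBlk (thm34_G_clause_final_blk)
open Literature.MathematicalPhysics.QuantumFieldTheory.Balaban1983to89.B9Ineq385Kernel (hasKernelBound_rate_mono gExt_kernelEntry_of_386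
  gExt_kernelEntry1_of_386)
open Literature.MathematicalPhysics.QuantumFieldTheory.Balaban1983to89.B9Ineq385KernelConcrete (eq386_resolvent_of_inverses ineq385_kernel_concreteV₃)

section Kernel

variable {𝔸 : Type*} [NormedRing 𝔸] [NormedAlgebra ℂ 𝔸] [CompleteSpace 𝔸] {ι : Type} [Fintype ι]
variable (b : Module.Basis ι ℝ 𝔸) {S : Type} {κ : Type} [Fintype κ] [LinearOrder κ]
variable (T : κ → Equiv.Perm S) (U : κ → S → 𝔸ˣ)
variable {g : B9.Geometry} [Fintype g.Site] {Rr : ℝ} {H : Prop}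

set_option maxHeartbeats 1600000 in
/-- **THEOREM 3.4, `G`-CLAUSE, WITH THE ENTRIES (3.42)₁,₂ OF `G(U′U)` IN THE PRINTED KERNEL FORM.**  FILE 20's `thm34_G_clause_final` verbatim (hypotheses
and conclusions), plus: from Theorem 3.3's (3.42)₁,₂ for `G(U)` as KERNEL bounds and (3.77) for the concrete `P₁(A)` of (3.76), the kernel bounds
`|G(U′U)(x,x′)| ≦ B′(Lʲη)²e^{−(δ₀/10)d(y,y′)}v(y′)⁻¹`, `|(∇_kG(U′U))(x,x′)| ≦ B′Lʲη·e^{−(δ₀/10)d}v(y′)⁻¹`, `B′ = B₀ + B·κ₃₈₅(…)α₁·c₁(1/100)` explicit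
(«the local ones follow from the bound (3.85) and Lemma 2.1 [4]», p. 407).
[cite: Balaban1985BackgroundPropagators, Thm 3.4 p.400 + (3.42) p.397 + (3.84)–(3.86) p.407 + (3.76)–(3.77) pp.405–406 + (3.82)–(3.83) p.407 + Thm 3.3 p.399; Balaban1984PropagatorsII, (2.51)–(2.55) p.232 + Lemma 2.1 p.234] -/
theorem thm34_G_kernelEntries_blk [Fintype S] [DecidableEq S] [DecidableEq ι] [DecidableEq g.Site] [Nonempty g.Site] (blk : S → g.Site) (d : ℕ)
    (δ₀ B₀ κQ BG B₁ cF Cq a₀ C₀ d₀ M₂ κQb cFb abar : ℝ)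
    (kQ : g.Site → S → 𝔸 →L[ℝ] 𝔸) (sQ : S → 𝔸 →L[ℝ] 𝔸) (cfun w : g.Site → ℝ)
    (hB₀ : 0 ≤ B₀) (hκQ : 0 < κQ) (hBG : 0 < BG) (hB₁ : 0 < B₁) (hcF : 0 < cF) (hCq : 0 ≤ Cq) (ha₀ : 0 ≤ a₀) (hC₀ : 0 ≤ C₀)
    (hM₂ : 0 ≤ M₂) (hδ₀ : 0 < δ₀) (hκQb : 0 ≤ κQb) (hcFb : 0 ≤ cFb) (habar : 0 ≤ abar)
    -- the multiscale geometry 𝔅 (p. 393, [4] (2.1)–(2.4)) and its axioms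
    (hdnn : ∀ a a' : g.Site, 0 ≤ g.dist a a') (htri : Triangle254 (toB6 g Rr H)) (hrefl : ∀ y : g.Site, g.dist y y = 0)
    (hsym : ∀ y y' : g.Site, g.dist y y' = g.dist y' y) (hlen : ∀ y : g.Site, 0 < g.len y) (hlenη : ∀ y : g.Site, g.eta ≤ g.len y)
    (hη : 0 < g.eta) (hL : 1 ≤ g.L)
    -- [4] Lemma 2.1 (2.61) at the rate `δ₀`, «for every 0 < α < 1»
    (h261 : ∀ α : ℝ, 0 < α → α < 1 → Ineq261 d (toB6 g Rr H) δ₀ α)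
    -- p. 398: «Using Lemma 2.1 in [4] we may replace the factor (Lʲη)^α by (Lʲη)^β(L^{j′}η)^γ with β + γ = α» — for every exponent, one
    -- constant `Λ(α) ≧ 1` for the six weights `(Lʲη)^{1,2,−1,−2,−4}` (natural and real powers)
    (hST : ∀ α : ℝ, 0 < α → ∃ Λ : ℝ, 1 ≤ Λ ∧ ScaleTransfer g δ₀ α Λ (fun a => g.len a) ∧ ScaleTransfer g δ₀ α Λ (fun a => g.len a ^ 2) ∧
      ScaleTransfer g δ₀ α Λ (fun a => (g.len a)⁻¹) ∧ ScaleTransfer g δ₀ α Λ (fun a => (g.len a ^ 2)⁻¹) ∧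
      ScaleTransfer g δ₀ α Λ (fun a => (g.len a ^ 4)⁻¹) ∧ ScaleTransfer g δ₀ α Λ (fun y => g.len y ^ (-(4 : ℝ))))
    -- real coordinates of `𝔸`, commuting translations, unitary-type background
    (hrepr : ∀ (v : 𝔸) (i : ι), |b.repr v i| ≤ M₂ * ‖v‖) (hT : ∀ (μ ν : κ) (x : S), T μ (T ν x) = T ν (T μ x))
    (hU1 : ∀ m z, ‖((U m z : 𝔸ˣ) : 𝔸)‖ ≤ 1 ∧ ‖(((U m z)⁻¹ : 𝔸ˣ) : 𝔸)‖ ≤ 1)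
    -- (3.35) on the plaquettes through each bond, at that bond's block scale; stencil geometry at range `d₀`
    (h35 : ∀ μ x m n y, Through T μ x m n y → ‖(plaqU T U m n y : 𝔸) - 1‖ ≤ C₀ * ((g.L ^ g.scale (blk x))⁻¹) ^ 2)
    (hd₀B : ∀ μ x, g.dist (blk x) (blk ((T μ).symm x)) ≤ d₀) (hd₀F : ∀ μ x, g.dist (blk x) (blk (T μ x)) ≤ d₀)
    (hd₀FB : ∀ μ ν x, g.dist (blk x) (blk ((T ν).symm (T μ x))) ≤ d₀)
    (hd₀st : ∀ μ x (q : κ × S), q ∈ stBonds T μ x → g.dist (blk x) (blk q.2) ≤ d₀)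
    (hd₀loc : ∀ μ x (q : κ × S), q ∈ B9Eq375Locality.locBondsA' T μ x → g.dist (blk x) (blk q.2) ≤ d₀)
    (hd₀0 : ∀ y : g.Site, g.dist y y ≤ d₀)
    -- the `A`-independent data of the concrete `V′(A)` of (3.60): (3.19) kernels/multipliers and the `a`-weights of (3.24)
    (hw : ∀ y, 0 ≤ w y) (hcard : ∀ y, ((B9Eq360Vprime.block blk y).card : ℝ) * w y ≤ 1)
    (hkQ : ∀ y x, blk x = y → ‖kQ y x‖ ≤ w y) (hsQ : ∀ x, ‖sQ x‖ ≤ 1) (hcfun : ∀ y, |cfun y| ≤ a₀ * (g.len y ^ 2)⁻¹)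
    -- THEOREM 3.1 for `G′(U)`: (3.42)₁,₂,₃ at the rate `δ₀`
    {Gp : Module.End ℝ (S × ι → ℝ)}
    (h342_1 : HasMajorant (g := toB6 g Rr H) (fun p : S × ι => blk p.1) Gp
      (fun a a' => BG * g.len a ^ 2 * Real.exp (-(δ₀ * g.dist a a'))))
    (h342_2 : ∀ k : κ ⊕ κ, HasMajorant (g := toB6 g Rr H) (fun p : S × ι => blk p.1)
      (conj b (diffLetter T U ((g.eta : ℂ)⁻¹) k) * Gp) (fun a a' => BG * g.len a * Real.exp (-(δ₀ * g.dist a a'))))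
    (h342_3 : ∀ k : κ ⊕ κ, HasMajorant (g := toB6 g Rr H) (fun p : S × ι => blk p.1)
      (Gp * conj b (diffLetter T U ((g.eta : ℂ)⁻¹) k)) (fun a a' => BG * g.len a * Real.exp (-(δ₀ * g.dist a a'))))
    -- THE BLOCK CARRIER OF THE `C`-LETTERS: any finite type `P` with block map `blkP : P → 𝔅` and an injective, block-compatible section
    -- `rep : P → S × ι` (FILE 17 `B6RandomWalkSection`); the (3.19) letters `Q′(U)`, `Q′*(U)` typed between the sites and `P`, block-local
    {P : Type} [Fintype P] [DecidableEq P] (blkP : P → g.Site) (rep : P → S × ι) (hrep : ∀ p : P, blk (rep p).1 = blkP p)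
    (hinj : Function.Injective rep)
    {Qc : (S × ι → ℝ) →ₗ[ℝ] (P → ℝ)} {Qcs : (P → ℝ) →ₗ[ℝ] (S × ι → ℝ)} {Linv : Module.End ℝ (P → ℝ)}
    (hQc : HasMajorantHom (g := toB6 g Rr H) (fun p : S × ι => blk p.1) blkP Qc
      (fun a a' : g.Site => κQ * (if a = a' then (1 : ℝ) else 0)))
    (hQcs : HasMajorantHom (g := toB6 g Rr H) blkP (fun p : S × ι => blk p.1) Qcs
      (fun a a' : g.Site => κQ * (if a = a' then (1 : ℝ) else 0)))
    -- THEOREM 3.2 for `U`: (3.21) `C⁻¹ = (Q′G′²Q′*)⁻¹` exists (`hLinv`, two-sided on `P → ℝ`) with (3.48) as a [4] (2.51) BLOCK MAJORANT over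
    -- `blkP` at the rate `δ₀` (r06 R-Ker-1 `B9Thm34InvBlk.thm34_Cinv_uniform_blk` delivers this currency; `hasMajorant_blk_iff` = ℓ¹ fibre rows)
    (hLinv : (Qc ∘ₗ (Gp * Gp) ∘ₗ Qcs) * Linv = 1)
    (h348 : HasMajorant (g := toB6 g Rr H) blkP Linv
      (fun a a' => B₁ * g.len a ^ (-(4 : ℝ)) * Real.exp (-(δ₀ * g.dist a a'))))
    -- the (3.15) bond letters `Q(U)`, `Q*(U)` and the weight letter `a` of (3.24)/(3.26), with their majorants
    {G Qs Q a : Module.End ℝ ((κ × S) × ι → ℝ)}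
    (hQb : HasMajorant (g := toB6 g Rr H) (fun q : (κ × S) × ι => blk q.1.2) Q (fun a a' => κQb * Real.exp (-(δ₀ * g.dist a a'))))
    (hQsb : HasMajorant (g := toB6 g Rr H) (fun q : (κ × S) × ι => blk q.1.2) Qs (fun a a' => κQb * Real.exp (-(δ₀ * g.dist a a'))))
    (ha324 : HasMajorant (g := toB6 g Rr H) (fun q : (κ × S) × ι => blk q.1.2) a
      (fun a a' : g.Site => if a = a' then abar * (g.len a ^ 2)⁻¹ else 0))
    -- THEOREM 3.3 for `G(U)`: two-sided inverse of the concrete `Δ_a(U)` and its (3.42)-entries at the rate `δ₀`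
    (hΔG : deltaA (conj b (lapDDLetter T ((g.eta : ℂ)⁻¹) U)) (conj b (dPrimeLetter T U g.eta))
      (conjHom b (gradLin T ((g.eta : ℂ)⁻¹) U) ∘ₗ (1 - (Gp ∘ₗ Qcs ∘ₗ Linv ∘ₗ Qc ∘ₗ Gp)) ∘ₗ conjHom b (divLin T ((g.eta : ℂ)⁻¹) U)) Qs a Q * G = 1)
    (hGΔ : G * deltaA (conj b (lapDDLetter T ((g.eta : ℂ)⁻¹) U)) (conj b (dPrimeLetter T U g.eta))
      (conjHom b (gradLin T ((g.eta : ℂ)⁻¹) U) ∘ₗ (1 - (Gp ∘ₗ Qcs ∘ₗ Linv ∘ₗ Qc ∘ₗ Gp)) ∘ₗ conjHom b (divLin T ((g.eta : ℂ)⁻¹) U)) Qs a Q = 1)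
    (hG : HasMajorant (g := toB6 g Rr H) (fun q : (κ × S) × ι => blk q.1.2) G
      (fun a a' => B₀ * g.len a ^ 2 * Real.exp (-(δ₀ * g.dist a a'))))
    (hDG : ∀ k : κ ⊕ κ, HasMajorant (g := toB6 g Rr H) (fun q : (κ × S) × ι => blk q.1.2)
      (conj b (diffLetter (bT T) (bU U) ((g.eta : ℂ)⁻¹) k) * G) (fun a a' => B₀ * g.len a * Real.exp (-(δ₀ * g.dist a a'))))
    (hGD : ∀ k : κ ⊕ κ, HasMajorant (g := toB6 g Rr H) (fun q : (κ × S) × ι => blk q.1.2)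
      (G * conj b (diffLetter (bT T) (bU U) ((g.eta : ℂ)⁻¹) k)) (fun a a' => B₀ * g.len a * Real.exp (-(δ₀ * g.dist a a'))))
    -- NEW (kernel form): Theorem 3.3's (3.42)₁,₂ for `G(U)` as PRINTED KERNEL BOUNDS (pairing weight `c = η^d`, volume weight `v(y′) = (L^j′ η)^d`)
    {v : g.Site → ℝ} (hv : ∀ y, 0 < v y) {c : ℝ} (hc : 0 < c)
    (hGk : HasKernelBound (g := toB6 g Rr H) (fun q : (κ × S) × ι => blk q.1.2) v c G
      (fun a a' => B₀ * g.len a ^ 2 * Real.exp (-(δ₀ * g.dist a a'))))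
    (hDGk : ∀ k : κ ⊕ κ, HasKernelBound (g := toB6 g Rr H) (fun q : (κ × S) × ι => blk q.1.2) v c
      (conj b (diffLetter (bT T) (bU U) ((g.eta : ℂ)⁻¹) k) * G) (fun a a' => B₀ * g.len a * Real.exp (-(δ₀ * g.dist a a')))) :
    ∃ a₁ : ℝ, 0 < a₁ ∧ ∃ B : ℝ, 0 ≤ B ∧ ∃ Λ : ℝ, 1 ≤ Λ ∧
    ∀ (α₁ : ℝ), 0 ≤ α₁ → α₁ ≤ a₁ →
    -- the exponent field `A` in the domain (3.37), read blockwise in the shapes of FILES 1–19, and the `A`-dependent (3.59) data `kF`, `sF`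
    ∀ (A : κ → S → 𝔸) (kF : g.Site → S → 𝔸 →L[ℝ] 𝔸) (sF : S → 𝔸 →L[ℝ] 𝔸),
      (∀ y x, blk x = y → ‖kF y x‖ ≤ Cq * α₁ * w y) → (∀ x, ‖sF x‖ ≤ Cq * α₁) →
      (∀ ν k x, ‖((g.eta : ℂ)⁻¹) • covDstar T U ν (A k) x‖ ≤ α₁ * (g.len (blk x) ^ 2)⁻¹) →
      (∀ μ ν x, ‖((g.eta : ℂ)⁻¹) • covD T U μ (A ν) x‖ ≤ α₁ * (g.len (blk x) ^ 2)⁻¹) →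
      (∀ μ ν x, ‖((g.eta : ℂ)⁻¹) • covDstar T U ν (A ν) (T μ x)‖ ≤ α₁ * (g.len (blk x) ^ 2)⁻¹) →
      (∀ μ x, ‖((g.eta : ℂ)⁻¹) • covDstar T U μ (tauB T U μ (A μ)) x‖ ≤ α₁ * (g.len (blk x) ^ 2)⁻¹) →
      (∀ μ ν k x, ‖((g.eta : ℂ)⁻¹) • covD T U μ (A k) ((T ν).symm x)‖ ≤ α₁ * (g.len (blk x) ^ 2)⁻¹) →
      (∀ k x, ‖A k x‖ ≤ α₁ * (g.len (blk x))⁻¹) → (∀ ν k x, ‖tauB T U ν (A k) x‖ ≤ α₁ * (g.len (blk x))⁻¹) →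
      (∀ μ k x, ‖tauF T U μ (A k) x‖ ≤ α₁ * (g.len (blk x))⁻¹) →
      (∀ k μ ν x, ‖A k ((T ν).symm (T μ x))‖ ≤ α₁ * (g.len (blk x))⁻¹) →
      (∀ μ x m z, (m, z) ∈ stBonds T μ x → ‖A m z‖ ≤ α₁ * (g.len (blk x))⁻¹) →
      (∀ μ x m z, (m, z) ∈ B9Eq375Locality.locBondsA T μ x → ‖A m z‖ ≤ α₁ * (g.len (blk x))⁻¹) →
      (∀ μ x m n y, Through T μ x m n y →
        ‖covD T U m (A n) y‖ ≤ g.eta * (α₁ * ((g.len (blk x))⁻¹) ^ 2) ∧ ‖covD T U n (A m) y‖ ≤ g.eta * (α₁ * ((g.len (blk x))⁻¹) ^ 2)) →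
    -- the (3.57)/(3.59) letters `F′₂(A)`, `F′₂*(A)` (block-local, size `c_F α₁`)
    ∀ {Qc' Fc : (S × ι → ℝ) →ₗ[ℝ] (P → ℝ)} {Qcs' Fcs : (P → ℝ) →ₗ[ℝ] (S × ι → ℝ)},
      Qc' = Qc + Fc → Qcs' = Qcs + Fcs →
      HasMajorantHom (g := toB6 g Rr H) (fun p : S × ι => blk p.1) blkP Fc
        (fun a a' : g.Site => cF * α₁ * (if a = a' then (1 : ℝ) else 0)) →
      HasMajorantHom (g := toB6 g Rr H) blkP (fun p : S × ι => blk p.1) Fcs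
        (fun a a' : g.Site => cF * α₁ * (if a = a' then (1 : ℝ) else 0)) →
    -- the (3.80)–(3.81) letters `F₂(A)`, `F₂*(A)` («|F₂(A)|, |F₂*(A)| ≦ O(1)α₁»), `P₂(A)` of (3.82)
    ∀ {P₂ Qs' Q' F₂ F₂s : Module.End ℝ ((κ × S) × ι → ℝ)},
      Q' = Q + F₂ → Qs' = Qs + F₂s → P₂ = pTwo Qs Q F₂ F₂s a →
      HasMajorant (g := toB6 g Rr H) (fun q : (κ × S) × ι => blk q.1.2) F₂ (fun a a' => cFb * α₁ * Real.exp (-(δ₀ * g.dist a a'))) →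
      HasMajorant (g := toB6 g Rr H) (fun q : (κ × S) × ι => blk q.1.2) F₂s (fun a a' => cFb * α₁ * Real.exp (-(δ₀ * g.dist a a'))) →
    ∃ (Tinv : Module.End ℝ (P → ℝ)) (GExt : Module.End ℝ ((κ × S) × ι → ℝ)),
      Tinv * (Qc' ∘ₗ ((gPrimeExtEnd Gp (conj b (vPrimeConc T U g.eta A blk kQ kF sQ sF cfun) * Gp)) * (gPrimeExtEnd Gp (conj b (vPrimeConc T U g.eta A blk kQ kF sQ sF cfun) * Gp))) ∘ₗ Qcs') = 1 ∧
      (Qc' ∘ₗ ((gPrimeExtEnd Gp (conj b (vPrimeConc T U g.eta A blk kQ kF sQ sF cfun) * Gp)) * (gPrimeExtEnd Gp (conj b (vPrimeConc T U g.eta A blk kQ kF sQ sF cfun) * Gp))) ∘ₗ Qcs') * Tinv = 1 ∧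
      deltaA (conj b (lapDDLetter T ((g.eta : ℂ)⁻¹) (prodCfg U g.eta A)))
          (conj b (dPrimeLetter T (prodCfg U g.eta A) g.eta))
          (conjHom b (gradLin T ((g.eta : ℂ)⁻¹) (prodCfg U g.eta A)) ∘ₗ (1 - ((Gp ∘ₗ Qcs ∘ₗ Linv ∘ₗ Qc ∘ₗ Gp) + (B9Eq360Vprime.pPrime Gp (gPrimeExtEnd Gp (conj b (vPrimeConc T U g.eta A blk kQ kF sQ sF cfun) * Gp)) (Qcs ∘ₗ secRes rep) (Qcs' ∘ₗ secRes rep) (secConj rep Linv) (secConj rep Tinv) (secExt rep ∘ₗ Qc) (secExt rep ∘ₗ Qc'))))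
            ∘ₗ conjHom b (divLin T ((g.eta : ℂ)⁻¹) (prodCfg U g.eta A))) Qs' a Q' * GExt = 1 ∧
      GExt *
      deltaA (conj b (lapDDLetter T ((g.eta : ℂ)⁻¹) (prodCfg U g.eta A)))
          (conj b (dPrimeLetter T (prodCfg U g.eta A) g.eta))
          (conjHom b (gradLin T ((g.eta : ℂ)⁻¹) (prodCfg U g.eta A)) ∘ₗ (1 - ((Gp ∘ₗ Qcs ∘ₗ Linv ∘ₗ Qc ∘ₗ Gp) + (B9Eq360Vprime.pPrime Gp (gPrimeExtEnd Gp (conj b (vPrimeConc T U g.eta A blk kQ kF sQ sF cfun) * Gp)) (Qcs ∘ₗ secRes rep) (Qcs' ∘ₗ secRes rep) (secConj rep Linv) (secConj rep Tinv) (secExt rep ∘ₗ Qc) (secExt rep ∘ₗ Qc'))))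
            ∘ₗ conjHom b (divLin T ((g.eta : ℂ)⁻¹) (prodCfg U g.eta A))) Qs' a Q' = 1 ∧
      (∀ (X : Module.End ℝ ((κ × S) × ι → ℝ)) (Pw : g.Site → ℝ), (∀ y, 0 ≤ Pw y) →
        HasMajorant (g := toB6 g Rr H) (fun q : (κ × S) × ι => blk q.1.2) (X * G)
          (fun a a' => B₀ * Pw a * Real.exp (-(δ₀ * g.dist a a'))) →
        HasMajorant (g := toB6 g Rr H) (fun q : (κ × S) × ι => blk q.1.2) (X * GExt)
          (fun a a' => B * Pw a * Real.exp (-(δ₀ / 6 * g.dist a a')))) ∧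
      (∀ Y : Module.End ℝ ((κ × S) × ι → ℝ),
        HasMajorant (g := toB6 g Rr H) (fun q : (κ × S) × ι => blk q.1.2) (G * Y)
          (fun a a' => B₀ * g.len a * Real.exp (-(δ₀ * g.dist a a'))) →
        HasMajorant (g := toB6 g Rr H) (fun q : (κ × S) × ι => blk q.1.2) (GExt * Y)
          (fun a a' => B * g.len a * Real.exp (-(δ₀ / 6 * g.dist a a')))) ∧
      -- NEW: (3.42)₁,₂ FOR `G(U′U)` IN THE PRINTED KERNEL FORM, given (3.77) for the concrete `P₁(A)` of (3.76) at the rate `δ₀/5`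
      (∀ κ₁ : ℝ, 0 ≤ κ₁ →
        HasMajorant (g := toB6 g Rr H) (fun q : (κ × S) × ι => blk q.1.2)
          ((conjHom b (gradLin T ((g.eta : ℂ)⁻¹) (prodCfg U g.eta A)) - conjHom b (gradLin T ((g.eta : ℂ)⁻¹) U)) ∘ₗ (Gp ∘ₗ Qcs ∘ₗ Linv ∘ₗ Qc ∘ₗ Gp) ∘ₗ conjHom b (divLin T ((g.eta : ℂ)⁻¹) U)
            + conjHom b (gradLin T ((g.eta : ℂ)⁻¹) U) ∘ₗ (Gp ∘ₗ Qcs ∘ₗ Linv ∘ₗ Qc ∘ₗ Gp) ∘ₗ (conjHom b (divLin T ((g.eta : ℂ)⁻¹) (prodCfg U g.eta A)) - conjHom b (divLin T ((g.eta : ℂ)⁻¹) U))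
            + (conjHom b (gradLin T ((g.eta : ℂ)⁻¹) (prodCfg U g.eta A)) - conjHom b (gradLin T ((g.eta : ℂ)⁻¹) U)) ∘ₗ (Gp ∘ₗ Qcs ∘ₗ Linv ∘ₗ Qc ∘ₗ Gp) ∘ₗ (conjHom b (divLin T ((g.eta : ℂ)⁻¹) (prodCfg U g.eta A)) - conjHom b (divLin T ((g.eta : ℂ)⁻¹) U))
            + conjHom b (gradLin T ((g.eta : ℂ)⁻¹) (prodCfg U g.eta A)) ∘ₗ (B9Eq360Vprime.pPrime Gp (gPrimeExtEnd Gp (conj b (vPrimeConc T U g.eta A blk kQ kF sQ sF cfun) * Gp)) (Qcs ∘ₗ secRes rep) (Qcs' ∘ₗ secRes rep) (secConj rep Linv) (secConj rep Tinv) (secExt rep ∘ₗ Qc) (secExt rep ∘ₗ Qc')) ∘ₗ conjHom b (divLin T ((g.eta : ℂ)⁻¹) (prodCfg U g.eta A)))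
          (fun a a' => κ₁ * α₁ * (g.len a ^ 2)⁻¹ * Real.exp (-(1 / 5 * δ₀ * g.dist a a'))) →
        HasKernelBound (g := toB6 g Rr H) (fun q : (κ × S) × ι => blk q.1.2) v c GExt
          (fun a a' => (B₀ + B * (kappa385 B₀ (cV385 (Fintype.card κ) α₁ C₀ (M₂ * (∑ i, ‖b i‖) * Real.exp (1 / 5 * δ₀ * d₀))) κ₁
            (kappa383 κQb cFb abar Λ (B6.c1 d δ₀ (1 / 100)) α₁) Λ (B6.c1 d δ₀ (1 / 100)) * α₁) * B6.c1 d δ₀ (1 / 100)) * g.len a ^ 2 * Real.exp (-(1 / 10 * δ₀ * g.dist a a'))) ∧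
        ∀ k : κ ⊕ κ, HasKernelBound (g := toB6 g Rr H) (fun q : (κ × S) × ι => blk q.1.2) v c
          (conj b (diffLetter (bT T) (bU U) ((g.eta : ℂ)⁻¹) k) * GExt)
          (fun a a' => (B₀ + B * (kappa385 B₀ (cV385 (Fintype.card κ) α₁ C₀ (M₂ * (∑ i, ‖b i‖) * Real.exp (1 / 5 * δ₀ * d₀))) κ₁
            (kappa383 κQb cFb abar Λ (B6.c1 d δ₀ (1 / 100)) α₁) Λ (B6.c1 d δ₀ (1 / 100)) * α₁) * B6.c1 d δ₀ (1 / 100)) * g.len a * Real.exp (-(1 / 10 * δ₀ * g.dist a a')))) := by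
  classical
  obtain ⟨a₁, ha₁, B, hB, Hmain⟩ := thm34_G_clause_final_blk (Rr := Rr) (H := H) b T U blk d δ₀ B₀ κQ BG B₁ cF Cq a₀ C₀ d₀ M₂ κQb cFb abar kQ sQ
    cfun w hB₀ hκQ hBG hB₁ hcF hCq ha₀ hC₀ hM₂ hδ₀ hκQb hcFb habar hdnn htri hrefl hsym hlen hlenη hη hL h261 hST hrepr hT hU1 h35 hd₀B hd₀F
    hd₀FB hd₀st hd₀loc hd₀0 hw hcard hkQ hsQ hcfun h342_1 h342_2 h342_3 blkP rep hrep hinj hQc hQcs hLinv h348 hQb hQsb ha324 hΔG hGΔ hG hDG hGD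
  obtain ⟨Λ, hΛ, hT1, hT2, -, hT2i, -, -⟩ := hST (1 / 100) (by norm_num)
  refine ⟨min a₁ (1 / 4), lt_min ha₁ (by norm_num), B, hB, Λ, hΛ, ?_⟩
  intro α₁ hα₁0 hα₁1 A kF sF hkF hsF h337B h337F h337B' h337Bτ h337FB hA hAτB hAτF hAFB hAst hAloc hdAst Qc' Fc Qcs' Fcs h357
    h357s hFc hFcs P₂ Qs' Q' F₂ F₂s h380 h380s hP₂def hF₂ hF₂s
  have hα₁a : α₁ ≤ a₁ := hα₁1.trans (min_le_left _ _)
  have hα₁q : α₁ ≤ 1 / 4 := hα₁1.trans (min_le_right _ _)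
  obtain ⟨Tinv, GExt, e1, e2, e3, e4, hLeft, hRight⟩ := Hmain α₁ hα₁0 hα₁a A kF sF hkF hsF h337B h337F h337B' h337Bτ h337FB hA hAτB
    hAτF hAFB hAst hAloc hdAst h357 h357s hFc hFcs h380 h380s hP₂def hF₂ hF₂s
  refine ⟨Tinv, GExt, e1, e2, e3, e4, hLeft, hRight, ?_⟩
  intro κ₁ hκ₁ hP₁
  -- constants and their signs
  have hΛ0 : 0 ≤ Λ := zero_le_one.trans hΛ
  have hSb : 0 ≤ ∑ i, ‖b i‖ := Finset.sum_nonneg fun i _ => norm_nonneg _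
  have hc₁ : 0 ≤ B6.c1 d δ₀ (1 / 100) := B6RandomWalk.c1_nonneg d δ₀ (1 / 100)
  have h261β : Ineq261 d (toB6 g Rr H) δ₀ (1 / 100) := h261 (1 / 100) (by norm_num) (by norm_num)
  have hκ₂0 : 0 ≤ kappa383 κQb cFb abar Λ (B6.c1 d δ₀ (1 / 100)) α₁ := kappa383_nonneg hκQb hcFb habar hΛ0 hc₁ hα₁0
  -- `η·α₁(Lʲη)⁻¹ ≦ 1/4` from `α₁ ≦ 1/4` and `η ≦ Lʲη`
  have hsmall : ∀ y : g.Site, g.eta * (α₁ * (g.len y)⁻¹) ≤ 1 / 4 := fun y => by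
    have hq : g.eta * (g.len y)⁻¹ ≤ 1 := by
      rw [← div_eq_mul_inv]; exact (div_le_one (hlen y)).mpr (hlenη y)
    calc g.eta * (α₁ * (g.len y)⁻¹) = α₁ * (g.eta * (g.len y)⁻¹) := by ring
      _ ≤ α₁ * 1 := mul_le_mul_of_nonneg_left hq hα₁0
      _ ≤ 1 / 4 := by linarith only [hα₁q]
  -- `P₂`'s (3.83) from the (3.15)/(3.80)–(3.81) letters (`B9Ineq385VG.ineq383_op`), at the rate `δ₀/5` (as in FILE 20)
  have hP₂ : HasMajorant (g := toB6 g Rr H) (fun q : (κ × S) × ι => blk q.1.2) P₂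
      (fun a a' => kappa383 κQb cFb abar Λ (B6.c1 d δ₀ (1 / 100)) α₁ * α₁ * (g.len a ^ 2)⁻¹ *
        Real.exp (-(1 / 5 * δ₀ * g.dist a a'))) := by
    rw [hP₂def]
    exact ineq383_op (R := Rr) (H := H) (fun q : (κ × S) × ι => blk q.1.2) d δ₀ δ₀ (1 / 100) (1 / 100) (1 / 5 * δ₀) Λ κQb cFb
      abar α₁ hκQb hcFb habar hα₁0 hΛ0 (by linarith only [hδ₀]) (by norm_num) (by norm_num) hδ₀.le (by linarith only [hδ₀]) hdnn htri
      h261β hT2i hQb hQsb hF₂ hF₂s ha324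
  -- (3.84) for the concrete operators and the resolvent form of (3.86) for FILE 20's `G(U′U)`
  have h371 := conj_lapDDLetter_prodCfg (b := b) (T := T) (U := U) hη.ne' A
  have h376 := eq376_concrete T U b hη.ne' A (Gp ∘ₗ Qcs ∘ₗ Linv ∘ₗ Qc ∘ₗ Gp)
    (B9Eq360Vprime.pPrime Gp (gPrimeExtEnd Gp (conj b (vPrimeConc T U g.eta A blk kQ kF sQ sF cfun) * Gp)) (Qcs ∘ₗ secRes rep) (Qcs' ∘ₗ secRes rep) (secConj rep Linv) (secConj rep Tinv) (secExt rep ∘ₗ Qc) (secExt rep ∘ₗ Qc'))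
  have h384 := eq384_sub _ _ (conj b (dPrimeLetter T U g.eta)) (conj b (dPrimeLetter T (prodCfg U g.eta A) g.eta)) _ _ Qs Qs' Q Q' a
    (conj b (V₁Op T U g.eta A)) (conj b (V₂Op T U g.eta A)) _ F₂ F₂s h371 h376 h380 h380s
  rw [← conj_V₃Op_eq_vThree, ← hP₂def] at h384
  have h386 := eq386_resolvent_of_inverses hΔG e4 h384
  -- (3.85) with the kernel bound on the right letter `G(U)`, for the concrete `V₃(A)` (FILE 23)
  have hw2 : ∀ a : g.Site, 0 ≤ g.len a ^ 2 := fun a => sq_nonneg _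
  have hGk5 := hasKernelBound_rate_mono (R := Rr) (H := H) (fun q : (κ × S) × ι => blk q.1.2) hv c B₀ (fun a => g.len a ^ 2) hB₀ hw2
    (show 1 / 5 * δ₀ ≤ δ₀ by linarith only [hδ₀]) hdnn hGk
  have hDGk5 : ∀ k : κ ⊕ κ, HasKernelBound (g := toB6 g Rr H) (fun q : (κ × S) × ι => blk q.1.2) v c
      (conj b (diffLetter (bT T) (bU U) ((g.eta : ℂ)⁻¹) k) * G)
      (fun a a' => B₀ * (g.len a ^ 2 * (g.len a)⁻¹) * Real.exp (-(1 / 5 * δ₀ * g.dist a a'))) := by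
    intro k
    have h := hasKernelBound_rate_mono (R := Rr) (H := H) (fun q : (κ × S) × ι => blk q.1.2) hv c B₀ (fun a => g.len a) hB₀
      (fun a => (hlen a).le) (show 1 / 5 * δ₀ ≤ δ₀ by linarith only [hδ₀]) hdnn (hDGk k)
    refine hasKernelBound_mono (g := toB6 g Rr H) _ hv h fun a a' => le_of_eq ?_
    have ha : g.len a ≠ 0 := (hlen a).ne'
    field_simp
  have hT2' : ScaleTransfer g δ₀ (1 / 100) Λ (fun a => g.len a ^ 2 * (g.len a)⁻¹) := by
    have e : (fun a : g.Site => g.len a ^ 2 * (g.len a)⁻¹) = fun a => g.len a := by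
      funext a; have ha : g.len a ≠ 0 := (hlen a).ne'; field_simp
    rw [e]; exact hT1
  have h385k := ineq385_kernel_concreteV₃ (Rr := Rr) (H := H) b T U blk d δ₀ (1 / 5 * δ₀) (1 / 100) (1 / 100) (1 / 10 * δ₀) Λ B₀ κ₁
    (kappa383 κQb cFb abar Λ (B6.c1 d δ₀ (1 / 100)) α₁) α₁ C₀ d₀ M₂ (fun a => g.len a ^ 2) hB₀ hκ₁ hκ₂0 hα₁0 hC₀ hΛ0
    (by linarith only [hδ₀]) (by norm_num) (by norm_num) hδ₀.le (by linarith only [hδ₀]) hM₂ (by linarith only [hδ₀]) hw2 hdnn htri hlen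
    h261β hT2 hT2' hrepr hη hL A hsmall hU1 h337B h337F h337B' hA hAτB hAτF hAst hAloc hdAst h35 hd₀B hd₀F hd₀FB hd₀st hd₀loc hd₀0
    hv hc hP₁ hP₂ hGk5 hDGk5
  -- the weight `len⁻² · len² = 1`
  have h385k' : HasKernelBound (g := toB6 g Rr H) (fun q : (κ × S) × ι => blk q.1.2) v c
      (vTotal (conj b (V₃Op T U g.eta A)) ((conjHom b (gradLin T ((g.eta : ℂ)⁻¹) (prodCfg U g.eta A)) - conjHom b (gradLin T ((g.eta : ℂ)⁻¹) U)) ∘ₗ (Gp ∘ₗ Qcs ∘ₗ Linv ∘ₗ Qc ∘ₗ Gp) ∘ₗ conjHom b (divLin T ((g.eta : ℂ)⁻¹) U) + conjHom b (gradLin T ((g.eta : ℂ)⁻¹) U) ∘ₗ (Gp ∘ₗ Qcs ∘ₗ Linv ∘ₗ Qc ∘ₗ Gp) ∘ₗ (conjHom b (divLin T ((g.eta : ℂ)⁻¹) (prodCfg U g.eta A)) - conjHom b (divLin T ((g.eta : ℂ)⁻¹) U)) + (conjHom b (gradLin T ((g.eta : ℂ)⁻¹) (prodCfg U g.eta A))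 - conjHom b (gradLin T ((g.eta : ℂ)⁻¹) U)) ∘ₗ (Gp ∘ₗ Qcs ∘ₗ Linv ∘ₗ Qc ∘ₗ Gp) ∘ₗ (conjHom b (divLin T ((g.eta : ℂ)⁻¹) (prodCfg U g.eta A)) - conjHom b (divLin T ((g.eta : ℂ)⁻¹) U)) + conjHom b (gradLin T ((g.eta : ℂ)⁻¹) (prodCfg U g.eta A)) ∘ₗ (B9Eq360Vprime.pPrime Gp (gPrimeExtEnd Gp (conj b (vPrimeConc T U g.eta A blk kQ kF sQ sF cfun) * Gp)) (Qcs ∘ₗ secRes rep) (Qcs' ∘ₗ secRes rep) (secConj rep Linv) (secConj rep Tinv) (secExt rep ∘ₗ Qc) (secExt rep ∘ₗ Qc')) ∘ₗ conjHom b (divLin T ((g.eta : ℂ)⁻¹) (prodCfg U g.eta A))) P₂ * G)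
      (fun a a' => (kappa385 B₀ (cV385 (Fintype.card κ) α₁ C₀ (M₂ * (∑ i, ‖b i‖) * Real.exp (1 / 5 * δ₀ * d₀))) κ₁ (kappa383 κQb cFb abar Λ (B6.c1 d δ₀ (1 / 100)) α₁) Λ (B6.c1 d δ₀ (1 / 100)) * α₁) * Real.exp (-(1 / 10 * δ₀ * g.dist a a'))) := by
    refine hasKernelBound_mono (g := toB6 g Rr H) _ hv h385k fun a a' => le_of_eq ?_
    have ha : g.len a ≠ 0 := (hlen a).ne'
    field_simp
  have hθ : 0 ≤ (kappa385 B₀ (cV385 (Fintype.card κ) α₁ C₀ (M₂ * (∑ i, ‖b i‖) * Real.exp (1 / 5 * δ₀ * d₀))) κ₁ (kappa383 κQb cFb abar Λ (B6.c1 d δ₀ (1 / 100)) α₁) Λ (B6.c1 d δ₀ (1 / 100)) * α₁) :=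
    mul_nonneg (kappa385_nonneg hB₀ (cV385_nonneg (Fintype.card κ) hα₁0 hC₀ (by positivity)) hκ₁ hκ₂0 hΛ0 hc₁) hα₁0
  -- entry (3.42)₁: `X = 1`
  have hGExt : HasMajorant (g := toB6 g Rr H) (fun q : (κ × S) × ι => blk q.1.2) GExt
      (fun a a' => B * g.len a ^ 2 * Real.exp (-(δ₀ / 6 * g.dist a a'))) := by
    have h := hLeft 1 (fun a => g.len a ^ 2) hw2 (by rw [one_mul]; exact hG)
    rw [one_mul] at h; exact h
  have hK1 := gExt_kernelEntry1_of_386 (R := Rr) (H := H) (fun q : (κ × S) × ι => blk q.1.2) d δ₀ (1 / 100) (1 / 100) (1 / 10 * δ₀) δ₀ (δ₀ / 6)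
    B₀ B _ hB₀ hB hθ (by linarith only [hδ₀]) (by linarith only [hδ₀]) (by linarith only [hδ₀]) (by linarith only [hδ₀]) hdnn htri h261β hv hc
    h386 hGk hGExt h385k'
  refine ⟨hasKernelBound_mono (g := toB6 g Rr H) _ hv hK1 fun a a' => le_of_eq (by ring), fun k => ?_⟩
  -- entry (3.42)₂: `X = ∇_k`
  have hST1 : ScaleTransfer g δ₀ (1 / 100) 1 (fun _ : g.Site => (1 : ℝ)) := fun y y' => by
    rw [mul_one, one_mul]
    exact Real.exp_le_one_iff.mpr (by nlinarith [hdnn y y', hδ₀])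
  have hXGExt := hLeft (conj b (diffLetter (bT T) (bU U) ((g.eta : ℂ)⁻¹) k)) (fun a => g.len a) (fun a => (hlen a).le) (hDG k)
  have h342' : HasKernelBound (g := toB6 g Rr H) (fun q : (κ × S) × ι => blk q.1.2) v c
      (conj b (diffLetter (bT T) (bU U) ((g.eta : ℂ)⁻¹) k) * G * 1) (fun a a' => B₀ * (g.len a * 1) * Real.exp (-(δ₀ * g.dist a a'))) := by
    rw [mul_one]; simpa only [mul_one] using hDGk k
  have h385'' : HasKernelBound (g := toB6 g Rr H) (fun q : (κ × S) × ι => blk q.1.2) v c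
      (vTotal (conj b (V₃Op T U g.eta A)) ((conjHom b (gradLin T ((g.eta : ℂ)⁻¹) (prodCfg U g.eta A)) - conjHom b (gradLin T ((g.eta : ℂ)⁻¹) U)) ∘ₗ (Gp ∘ₗ Qcs ∘ₗ Linv ∘ₗ Qc ∘ₗ Gp) ∘ₗ conjHom b (divLin T ((g.eta : ℂ)⁻¹) U) + conjHom b (gradLin T ((g.eta : ℂ)⁻¹) U) ∘ₗ (Gp ∘ₗ Qcs ∘ₗ Linv ∘ₗ Qc ∘ₗ Gp) ∘ₗ (conjHom b (divLin T ((g.eta : ℂ)⁻¹) (prodCfg U g.eta A)) - conjHom b (divLin T ((g.eta : ℂ)⁻¹) U)) + (conjHom b (gradLin T ((g.eta : ℂ)⁻¹) (prodCfg U g.eta A)) - conjHom b (gradLin T ((g.eta : ℂ)⁻¹) U)) ∘ₗ (Gp ∘ₗ Qcs ∘ₗ Linv ∘ₗ Qc ∘ₗ Gp) ∘ₗ (conjHom b (divLin T ((g.eta : ℂ)⁻¹) (prodCfg U g.eta A)) - conjHom b (divLin T ((g.eta : ℂ)⁻¹) U)) + conjHom b (gradLin T ((g.eta : ℂ)⁻¹)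 (prodCfg U g.eta A)) ∘ₗ (B9Eq360Vprime.pPrime Gp (gPrimeExtEnd Gp (conj b (vPrimeConc T U g.eta A blk kQ kF sQ sF cfun) * Gp)) (Qcs ∘ₗ secRes rep) (Qcs' ∘ₗ secRes rep) (secConj rep Linv) (secConj rep Tinv) (secExt rep ∘ₗ Qc) (secExt rep ∘ₗ Qc')) ∘ₗ conjHom b (divLin T ((g.eta : ℂ)⁻¹) (prodCfg U g.eta A))) P₂ * G * 1)
      (fun a a' => (kappa385 B₀ (cV385 (Fintype.card κ) α₁ C₀ (M₂ * (∑ i, ‖b i‖) * Real.exp (1 / 5 * δ₀ * d₀))) κ₁ (kappa383 κQb cFb abar Λ (B6.c1 d δ₀ (1 / 100)) α₁) Λ (B6.c1 d δ₀ (1 / 100)) * α₁) * 1 * Real.exp (-(1 / 10 * δ₀ * g.dist a a'))) := by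
    rw [mul_one]; simpa only [mul_one] using h385k'
  have hK2 := gExt_kernelEntry_of_386 (R := Rr) (H := H) (fun q : (κ × S) × ι => blk q.1.2) d δ₀ (1 / 100) (1 / 100) (1 / 10 * δ₀) δ₀ (δ₀ / 6) 1
    B₀ B _ (fun a => g.len a) (fun _ => 1) hB₀ hB hθ (fun a => (hlen a).le) (fun _ => zero_le_one) zero_le_one (by linarith only [hδ₀])
    (by linarith only [hδ₀]) (by linarith only [hδ₀]) hdnn htri hST1 h261β hv hc h386 h342' hXGExt h385''
  rw [mul_one] at hK2
  exact hasKernelBound_mono (g := toB6 g Rr H) _ hv hK2 fun a a' => le_of_eq (by ring)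


set_option maxHeartbeats 1600000 in
/-- **THEOREM 3.4, `G`-CLAUSE, WITH ALL FOUR ENTRIES OF (3.42) FOR `G(U′U)` IN THE PRINTED KERNEL FORM** (v1.1 of this file): as
`thm34_G_kernelEntries`, with Theorem 3.3's (3.42)₃,₄ for `G(U)` as kernel inputs too (`hGDk`, `hDGDk`), and the four conclusions
`|(X·G(U′U)·Y)(x,x′)| ≦ (B₀ + B·θ·Λ·c₁(1/100))·[(Lʲη)², Lʲη, Lʲη, 1]·e^{−(δ₀/10)d(y,y′)}·v(y′)⁻¹` for `(X,Y) ∈ {1,∇_k} × {1,∇*_l}` — the right letter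
`Y = ∇*_l` enters through (3.85) in kernel form for `Tr = G(U)∇*_l` (weight `Lʲη`, FILE 23) and the scale transfer `Λ` for the weight `(Lʲη)^{−1}`.
[cite: Balaban1985BackgroundPropagators, Thm 3.4 p.400 + (3.42) p.397 + (3.84)–(3.86) p.407 + (3.76)–(3.77) pp.405–406 + Thm 3.3 p.399; Balaban1984PropagatorsII, (2.51)–(2.55) p.232 + Lemma 2.1 p.234] -/
theorem thm34_G_kernelEntriesAll_blk [Fintype S] [DecidableEq S] [DecidableEq ι] [DecidableEq g.Site] [Nonempty g.Site] (blk : S → g.Site) (d : ℕ)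
    (δ₀ B₀ κQ BG B₁ cF Cq a₀ C₀ d₀ M₂ κQb cFb abar : ℝ)
    (kQ : g.Site → S → 𝔸 →L[ℝ] 𝔸) (sQ : S → 𝔸 →L[ℝ] 𝔸) (cfun w : g.Site → ℝ)
    (hB₀ : 0 ≤ B₀) (hκQ : 0 < κQ) (hBG : 0 < BG) (hB₁ : 0 < B₁) (hcF : 0 < cF) (hCq : 0 ≤ Cq) (ha₀ : 0 ≤ a₀) (hC₀ : 0 ≤ C₀)
    (hM₂ : 0 ≤ M₂) (hδ₀ : 0 < δ₀) (hκQb : 0 ≤ κQb) (hcFb : 0 ≤ cFb) (habar : 0 ≤ abar)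
    -- the multiscale geometry 𝔅 (p. 393, [4] (2.1)–(2.4)) and its axioms
    (hdnn : ∀ a a' : g.Site, 0 ≤ g.dist a a') (htri : Triangle254 (toB6 g Rr H)) (hrefl : ∀ y : g.Site, g.dist y y = 0)
    (hsym : ∀ y y' : g.Site, g.dist y y' = g.dist y' y) (hlen : ∀ y : g.Site, 0 < g.len y) (hlenη : ∀ y : g.Site, g.eta ≤ g.len y)
    (hη : 0 < g.eta) (hL : 1 ≤ g.L)
    -- [4] Lemma 2.1 (2.61) at the rate `δ₀`, «for every 0 < α < 1»
    (h261 : ∀ α : ℝ, 0 < α → α < 1 → Ineq261 d (toB6 g Rr H) δ₀ α)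
    -- p. 398: «Using Lemma 2.1 in [4] we may replace the factor (Lʲη)^α by (Lʲη)^β(L^{j′}η)^γ with β + γ = α» — for every exponent, one
    -- constant `Λ(α) ≧ 1` for the six weights `(Lʲη)^{1,2,−1,−2,−4}` (natural and real powers)
    (hST : ∀ α : ℝ, 0 < α → ∃ Λ : ℝ, 1 ≤ Λ ∧ ScaleTransfer g δ₀ α Λ (fun a => g.len a) ∧ ScaleTransfer g δ₀ α Λ (fun a => g.len a ^ 2) ∧
      ScaleTransfer g δ₀ α Λ (fun a => (g.len a)⁻¹) ∧ ScaleTransfer g δ₀ α Λ (fun a => (g.len a ^ 2)⁻¹) ∧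
      ScaleTransfer g δ₀ α Λ (fun a => (g.len a ^ 4)⁻¹) ∧ ScaleTransfer g δ₀ α Λ (fun y => g.len y ^ (-(4 : ℝ))))
    -- real coordinates of `𝔸`, commuting translations, unitary-type background
    (hrepr : ∀ (v : 𝔸) (i : ι), |b.repr v i| ≤ M₂ * ‖v‖) (hT : ∀ (μ ν : κ) (x : S), T μ (T ν x) = T ν (T μ x))
    (hU1 : ∀ m z, ‖((U m z : 𝔸ˣ) : 𝔸)‖ ≤ 1 ∧ ‖(((U m z)⁻¹ : 𝔸ˣ) : 𝔸)‖ ≤ 1)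
    -- (3.35) on the plaquettes through each bond, at that bond's block scale; stencil geometry at range `d₀`
    (h35 : ∀ μ x m n y, Through T μ x m n y → ‖(plaqU T U m n y : 𝔸) - 1‖ ≤ C₀ * ((g.L ^ g.scale (blk x))⁻¹) ^ 2)
    (hd₀B : ∀ μ x, g.dist (blk x) (blk ((T μ).symm x)) ≤ d₀) (hd₀F : ∀ μ x, g.dist (blk x) (blk (T μ x)) ≤ d₀)
    (hd₀FB : ∀ μ ν x, g.dist (blk x) (blk ((T ν).symm (T μ x))) ≤ d₀)
    (hd₀st : ∀ μ x (q : κ × S), q ∈ stBonds T μ x → g.dist (blk x) (blk q.2) ≤ d₀)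
    (hd₀loc : ∀ μ x (q : κ × S), q ∈ B9Eq375Locality.locBondsA' T μ x → g.dist (blk x) (blk q.2) ≤ d₀)
    (hd₀0 : ∀ y : g.Site, g.dist y y ≤ d₀)
    -- the `A`-independent data of the concrete `V′(A)` of (3.60): (3.19) kernels/multipliers and the `a`-weights of (3.24)
    (hw : ∀ y, 0 ≤ w y) (hcard : ∀ y, ((B9Eq360Vprime.block blk y).card : ℝ) * w y ≤ 1)
    (hkQ : ∀ y x, blk x = y → ‖kQ y x‖ ≤ w y) (hsQ : ∀ x, ‖sQ x‖ ≤ 1) (hcfun : ∀ y, |cfun y| ≤ a₀ * (g.len y ^ 2)⁻¹)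
    -- THEOREM 3.1 for `G′(U)`: (3.42)₁,₂,₃ at the rate `δ₀`
    {Gp : Module.End ℝ (S × ι → ℝ)}
    (h342_1 : HasMajorant (g := toB6 g Rr H) (fun p : S × ι => blk p.1) Gp
      (fun a a' => BG * g.len a ^ 2 * Real.exp (-(δ₀ * g.dist a a'))))
    (h342_2 : ∀ k : κ ⊕ κ, HasMajorant (g := toB6 g Rr H) (fun p : S × ι => blk p.1)
      (conj b (diffLetter T U ((g.eta : ℂ)⁻¹) k) * Gp) (fun a a' => BG * g.len a * Real.exp (-(δ₀ * g.dist a a'))))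
    (h342_3 : ∀ k : κ ⊕ κ, HasMajorant (g := toB6 g Rr H) (fun p : S × ι => blk p.1)
      (Gp * conj b (diffLetter T U ((g.eta : ℂ)⁻¹) k)) (fun a a' => BG * g.len a * Real.exp (-(δ₀ * g.dist a a'))))
    -- THE BLOCK CARRIER OF THE `C`-LETTERS: any finite type `P` with block map `blkP : P → 𝔅` and an injective, block-compatible section
    -- `rep : P → S × ι` (FILE 17 `B6RandomWalkSection`); the (3.19) letters `Q′(U)`, `Q′*(U)` typed between the sites and `P`, block-local
    {P : Type} [Fintype P] [DecidableEq P] (blkP : P → g.Site) (rep : P → S × ι) (hrep : ∀ p : P, blk (rep p).1 = blkP p)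
    (hinj : Function.Injective rep)
    {Qc : (S × ι → ℝ) →ₗ[ℝ] (P → ℝ)} {Qcs : (P → ℝ) →ₗ[ℝ] (S × ι → ℝ)} {Linv : Module.End ℝ (P → ℝ)}
    (hQc : HasMajorantHom (g := toB6 g Rr H) (fun p : S × ι => blk p.1) blkP Qc
      (fun a a' : g.Site => κQ * (if a = a' then (1 : ℝ) else 0)))
    (hQcs : HasMajorantHom (g := toB6 g Rr H) blkP (fun p : S × ι => blk p.1) Qcs
      (fun a a' : g.Site => κQ * (if a = a' then (1 : ℝ) else 0)))
    -- THEOREM 3.2 for `U`: (3.21) `C⁻¹ = (Q′G′²Q′*)⁻¹` exists (`hLinv`, two-sided on `P → ℝ`) with (3.48) as a [4] (2.51) BLOCK MAJORANT over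
    -- `blkP` at the rate `δ₀` (r06 R-Ker-1 `B9Thm34InvBlk.thm34_Cinv_uniform_blk` delivers this currency; `hasMajorant_blk_iff` = ℓ¹ fibre rows)
    (hLinv : (Qc ∘ₗ (Gp * Gp) ∘ₗ Qcs) * Linv = 1)
    (h348 : HasMajorant (g := toB6 g Rr H) blkP Linv
      (fun a a' => B₁ * g.len a ^ (-(4 : ℝ)) * Real.exp (-(δ₀ * g.dist a a'))))
    -- the (3.15) bond letters `Q(U)`, `Q*(U)` and the weight letter `a` of (3.24)/(3.26), with their majorants
    {G Qs Q a : Module.End ℝ ((κ × S) × ι → ℝ)}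
    (hQb : HasMajorant (g := toB6 g Rr H) (fun q : (κ × S) × ι => blk q.1.2) Q (fun a a' => κQb * Real.exp (-(δ₀ * g.dist a a'))))
    (hQsb : HasMajorant (g := toB6 g Rr H) (fun q : (κ × S) × ι => blk q.1.2) Qs (fun a a' => κQb * Real.exp (-(δ₀ * g.dist a a'))))
    (ha324 : HasMajorant (g := toB6 g Rr H) (fun q : (κ × S) × ι => blk q.1.2) a
      (fun a a' : g.Site => if a = a' then abar * (g.len a ^ 2)⁻¹ else 0))
    -- THEOREM 3.3 for `G(U)`: two-sided inverse of the concrete `Δ_a(U)` and its (3.42)-entries at the rate `δ₀`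
    (hΔG : deltaA (conj b (lapDDLetter T ((g.eta : ℂ)⁻¹) U)) (conj b (dPrimeLetter T U g.eta))
      (conjHom b (gradLin T ((g.eta : ℂ)⁻¹) U) ∘ₗ (1 - (Gp ∘ₗ Qcs ∘ₗ Linv ∘ₗ Qc ∘ₗ Gp)) ∘ₗ conjHom b (divLin T ((g.eta : ℂ)⁻¹) U)) Qs a Q * G = 1)
    (hGΔ : G * deltaA (conj b (lapDDLetter T ((g.eta : ℂ)⁻¹) U)) (conj b (dPrimeLetter T U g.eta))
      (conjHom b (gradLin T ((g.eta : ℂ)⁻¹) U) ∘ₗ (1 - (Gp ∘ₗ Qcs ∘ₗ Linv ∘ₗ Qc ∘ₗ Gp)) ∘ₗ conjHom b (divLin T ((g.eta : ℂ)⁻¹) U)) Qs a Q = 1)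
    (hG : HasMajorant (g := toB6 g Rr H) (fun q : (κ × S) × ι => blk q.1.2) G
      (fun a a' => B₀ * g.len a ^ 2 * Real.exp (-(δ₀ * g.dist a a'))))
    (hDG : ∀ k : κ ⊕ κ, HasMajorant (g := toB6 g Rr H) (fun q : (κ × S) × ι => blk q.1.2)
      (conj b (diffLetter (bT T) (bU U) ((g.eta : ℂ)⁻¹) k) * G) (fun a a' => B₀ * g.len a * Real.exp (-(δ₀ * g.dist a a'))))
    (hGD : ∀ k : κ ⊕ κ, HasMajorant (g := toB6 g Rr H) (fun q : (κ × S) × ι => blk q.1.2)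
      (G * conj b (diffLetter (bT T) (bU U) ((g.eta : ℂ)⁻¹) k)) (fun a a' => B₀ * g.len a * Real.exp (-(δ₀ * g.dist a a'))))
    -- NEW (kernel form): Theorem 3.3's (3.42)₁,₂,₃,₄ for `G(U)` as PRINTED KERNEL BOUNDS (pairing weight `c = η^d`, volume weight `v(y′) = (L^j′ η)^d`)
    {v : g.Site → ℝ} (hv : ∀ y, 0 < v y) {c : ℝ} (hc : 0 < c)
    (hGk : HasKernelBound (g := toB6 g Rr H) (fun q : (κ × S) × ι => blk q.1.2) v c G
      (fun a a' => B₀ * g.len a ^ 2 * Real.exp (-(δ₀ * g.dist a a'))))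
    (hDGk : ∀ k : κ ⊕ κ, HasKernelBound (g := toB6 g Rr H) (fun q : (κ × S) × ι => blk q.1.2) v c
      (conj b (diffLetter (bT T) (bU U) ((g.eta : ℂ)⁻¹) k) * G) (fun a a' => B₀ * g.len a * Real.exp (-(δ₀ * g.dist a a'))))
    (hGDk : ∀ l : κ ⊕ κ, HasKernelBound (g := toB6 g Rr H) (fun q : (κ × S) × ι => blk q.1.2) v c
      (G * conj b (diffLetter (bT T) (bU U) ((g.eta : ℂ)⁻¹) l)) (fun a a' => B₀ * g.len a * Real.exp (-(δ₀ * g.dist a a'))))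
    (hDGDk : ∀ k l : κ ⊕ κ, HasKernelBound (g := toB6 g Rr H) (fun q : (κ × S) × ι => blk q.1.2) v c
      (conj b (diffLetter (bT T) (bU U) ((g.eta : ℂ)⁻¹) k) * G * conj b (diffLetter (bT T) (bU U) ((g.eta : ℂ)⁻¹) l)) (fun a a' => B₀ * Real.exp (-(δ₀ * g.dist a a')))) :
    ∃ a₁ : ℝ, 0 < a₁ ∧ ∃ B : ℝ, 0 ≤ B ∧ ∃ Λ : ℝ, 1 ≤ Λ ∧
    ∀ (α₁ : ℝ), 0 ≤ α₁ → α₁ ≤ a₁ →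
    -- the exponent field `A` in the domain (3.37), read blockwise in the shapes of FILES 1–19, and the `A`-dependent (3.59) data `kF`, `sF`
    ∀ (A : κ → S → 𝔸) (kF : g.Site → S → 𝔸 →L[ℝ] 𝔸) (sF : S → 𝔸 →L[ℝ] 𝔸),
      (∀ y x, blk x = y → ‖kF y x‖ ≤ Cq * α₁ * w y) → (∀ x, ‖sF x‖ ≤ Cq * α₁) →
      (∀ ν k x, ‖((g.eta : ℂ)⁻¹) • covDstar T U ν (A k) x‖ ≤ α₁ * (g.len (blk x) ^ 2)⁻¹) →
      (∀ μ ν x, ‖((g.eta : ℂ)⁻¹) • covD T U μ (A ν) x‖ ≤ α₁ * (g.len (blk x) ^ 2)⁻¹) →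
      (∀ μ ν x, ‖((g.eta : ℂ)⁻¹) • covDstar T U ν (A ν) (T μ x)‖ ≤ α₁ * (g.len (blk x) ^ 2)⁻¹) →
      (∀ μ x, ‖((g.eta : ℂ)⁻¹) • covDstar T U μ (tauB T U μ (A μ)) x‖ ≤ α₁ * (g.len (blk x) ^ 2)⁻¹) →
      (∀ μ ν k x, ‖((g.eta : ℂ)⁻¹) • covD T U μ (A k) ((T ν).symm x)‖ ≤ α₁ * (g.len (blk x) ^ 2)⁻¹) →
      (∀ k x, ‖A k x‖ ≤ α₁ * (g.len (blk x))⁻¹) → (∀ ν k x, ‖tauB T U ν (A k) x‖ ≤ α₁ * (g.len (blk x))⁻¹) →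
      (∀ μ k x, ‖tauF T U μ (A k) x‖ ≤ α₁ * (g.len (blk x))⁻¹) →
      (∀ k μ ν x, ‖A k ((T ν).symm (T μ x))‖ ≤ α₁ * (g.len (blk x))⁻¹) →
      (∀ μ x m z, (m, z) ∈ stBonds T μ x → ‖A m z‖ ≤ α₁ * (g.len (blk x))⁻¹) →
      (∀ μ x m z, (m, z) ∈ B9Eq375Locality.locBondsA T μ x → ‖A m z‖ ≤ α₁ * (g.len (blk x))⁻¹) →
      (∀ μ x m n y, Through T μ x m n y →
        ‖covD T U m (A n) y‖ ≤ g.eta * (α₁ * ((g.len (blk x))⁻¹) ^ 2) ∧ ‖covD T U n (A m) y‖ ≤ g.eta * (α₁ * ((g.len (blk x))⁻¹) ^ 2)) →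
    -- the (3.57)/(3.59) letters `F′₂(A)`, `F′₂*(A)` (block-local, size `c_F α₁`)
    ∀ {Qc' Fc : (S × ι → ℝ) →ₗ[ℝ] (P → ℝ)} {Qcs' Fcs : (P → ℝ) →ₗ[ℝ] (S × ι → ℝ)},
      Qc' = Qc + Fc → Qcs' = Qcs + Fcs →
      HasMajorantHom (g := toB6 g Rr H) (fun p : S × ι => blk p.1) blkP Fc
        (fun a a' : g.Site => cF * α₁ * (if a = a' then (1 : ℝ) else 0)) →
      HasMajorantHom (g := toB6 g Rr H) blkP (fun p : S × ι => blk p.1) Fcs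
        (fun a a' : g.Site => cF * α₁ * (if a = a' then (1 : ℝ) else 0)) →
    -- the (3.80)–(3.81) letters `F₂(A)`, `F₂*(A)` («|F₂(A)|, |F₂*(A)| ≦ O(1)α₁»), `P₂(A)` of (3.82)
    ∀ {P₂ Qs' Q' F₂ F₂s : Module.End ℝ ((κ × S) × ι → ℝ)},
      Q' = Q + F₂ → Qs' = Qs + F₂s → P₂ = pTwo Qs Q F₂ F₂s a →
      HasMajorant (g := toB6 g Rr H) (fun q : (κ × S) × ι => blk q.1.2) F₂ (fun a a' => cFb * α₁ * Real.exp (-(δ₀ * g.dist a a'))) →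
      HasMajorant (g := toB6 g Rr H) (fun q : (κ × S) × ι => blk q.1.2) F₂s (fun a a' => cFb * α₁ * Real.exp (-(δ₀ * g.dist a a'))) →
    ∃ (Tinv : Module.End ℝ (P → ℝ)) (GExt : Module.End ℝ ((κ × S) × ι → ℝ)),
      Tinv * (Qc' ∘ₗ ((gPrimeExtEnd Gp (conj b (vPrimeConc T U g.eta A blk kQ kF sQ sF cfun) * Gp)) * (gPrimeExtEnd Gp (conj b (vPrimeConc T U g.eta A blk kQ kF sQ sF cfun) * Gp))) ∘ₗ Qcs') = 1 ∧
      (Qc' ∘ₗ ((gPrimeExtEnd Gp (conj b (vPrimeConc T U g.eta A blk kQ kF sQ sF cfun) * Gp)) * (gPrimeExtEnd Gp (conj b (vPrimeConc T U g.eta A blk kQ kF sQ sF cfun) * Gp))) ∘ₗ Qcs') * Tinv = 1 ∧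
      deltaA (conj b (lapDDLetter T ((g.eta : ℂ)⁻¹) (prodCfg U g.eta A)))
          (conj b (dPrimeLetter T (prodCfg U g.eta A) g.eta))
          (conjHom b (gradLin T ((g.eta : ℂ)⁻¹) (prodCfg U g.eta A)) ∘ₗ (1 - ((Gp ∘ₗ Qcs ∘ₗ Linv ∘ₗ Qc ∘ₗ Gp) + (B9Eq360Vprime.pPrime Gp (gPrimeExtEnd Gp (conj b (vPrimeConc T U g.eta A blk kQ kF sQ sF cfun) * Gp)) (Qcs ∘ₗ secRes rep) (Qcs' ∘ₗ secRes rep) (secConj rep Linv) (secConj rep Tinv) (secExt rep ∘ₗ Qc) (secExt rep ∘ₗ Qc'))))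
            ∘ₗ conjHom b (divLin T ((g.eta : ℂ)⁻¹) (prodCfg U g.eta A))) Qs' a Q' * GExt = 1 ∧
      GExt *
      deltaA (conj b (lapDDLetter T ((g.eta : ℂ)⁻¹) (prodCfg U g.eta A)))
          (conj b (dPrimeLetter T (prodCfg U g.eta A) g.eta))
          (conjHom b (gradLin T ((g.eta : ℂ)⁻¹) (prodCfg U g.eta A)) ∘ₗ (1 - ((Gp ∘ₗ Qcs ∘ₗ Linv ∘ₗ Qc ∘ₗ Gp) + (B9Eq360Vprime.pPrime Gp (gPrimeExtEnd Gp (conj b (vPrimeConc T U g.eta A blk kQ kF sQ sF cfun) * Gp)) (Qcs ∘ₗ secRes rep) (Qcs' ∘ₗ secRes rep) (secConj rep Linv) (secConj rep Tinv) (secExt rep ∘ₗ Qc) (secExt rep ∘ₗ Qc'))))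
            ∘ₗ conjHom b (divLin T ((g.eta : ℂ)⁻¹) (prodCfg U g.eta A))) Qs' a Q' = 1 ∧
      (∀ (X : Module.End ℝ ((κ × S) × ι → ℝ)) (Pw : g.Site → ℝ), (∀ y, 0 ≤ Pw y) →
        HasMajorant (g := toB6 g Rr H) (fun q : (κ × S) × ι => blk q.1.2) (X * G)
          (fun a a' => B₀ * Pw a * Real.exp (-(δ₀ * g.dist a a'))) →
        HasMajorant (g := toB6 g Rr H) (fun q : (κ × S) × ι => blk q.1.2) (X * GExt)
          (fun a a' => B * Pw a * Real.exp (-(δ₀ / 6 * g.dist a a')))) ∧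
      (∀ Y : Module.End ℝ ((κ × S) × ι → ℝ),
        HasMajorant (g := toB6 g Rr H) (fun q : (κ × S) × ι => blk q.1.2) (G * Y)
          (fun a a' => B₀ * g.len a * Real.exp (-(δ₀ * g.dist a a'))) →
        HasMajorant (g := toB6 g Rr H) (fun q : (κ × S) × ι => blk q.1.2) (GExt * Y)
          (fun a a' => B * g.len a * Real.exp (-(δ₀ / 6 * g.dist a a')))) ∧
      -- NEW: ALL FOUR ENTRIES OF (3.42) FOR `G(U′U)` IN THE PRINTED KERNEL FORM, given (3.77) for the concrete `P₁(A)` of (3.76) at the rate `δ₀/5`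
      (∀ κ₁ : ℝ, 0 ≤ κ₁ →
        HasMajorant (g := toB6 g Rr H) (fun q : (κ × S) × ι => blk q.1.2)
          ((conjHom b (gradLin T ((g.eta : ℂ)⁻¹) (prodCfg U g.eta A)) - conjHom b (gradLin T ((g.eta : ℂ)⁻¹) U)) ∘ₗ (Gp ∘ₗ Qcs ∘ₗ Linv ∘ₗ Qc ∘ₗ Gp) ∘ₗ conjHom b (divLin T ((g.eta : ℂ)⁻¹) U)
            + conjHom b (gradLin T ((g.eta : ℂ)⁻¹) U) ∘ₗ (Gp ∘ₗ Qcs ∘ₗ Linv ∘ₗ Qc ∘ₗ Gp) ∘ₗ (conjHom b (divLin T ((g.eta : ℂ)⁻¹) (prodCfg U g.eta A)) - conjHom b (divLin T ((g.eta : ℂ)⁻¹) U))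
            + (conjHom b (gradLin T ((g.eta : ℂ)⁻¹) (prodCfg U g.eta A)) - conjHom b (gradLin T ((g.eta : ℂ)⁻¹) U)) ∘ₗ (Gp ∘ₗ Qcs ∘ₗ Linv ∘ₗ Qc ∘ₗ Gp) ∘ₗ (conjHom b (divLin T ((g.eta : ℂ)⁻¹) (prodCfg U g.eta A)) - conjHom b (divLin T ((g.eta : ℂ)⁻¹) U))
            + conjHom b (gradLin T ((g.eta : ℂ)⁻¹) (prodCfg U g.eta A)) ∘ₗ (B9Eq360Vprime.pPrime Gp (gPrimeExtEnd Gp (conj b (vPrimeConc T U g.eta A blk kQ kF sQ sF cfun) * Gp)) (Qcs ∘ₗ secRes rep) (Qcs' ∘ₗ secRes rep) (secConj rep Linv) (secConj rep Tinv) (secExt rep ∘ₗ Qc) (secExt rep ∘ₗ Qc')) ∘ₗ conjHom b (divLin T ((g.eta : ℂ)⁻¹) (prodCfg U g.eta A)))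
          (fun a a' => κ₁ * α₁ * (g.len a ^ 2)⁻¹ * Real.exp (-(1 / 5 * δ₀ * g.dist a a'))) →
        HasKernelBound (g := toB6 g Rr H) (fun q : (κ × S) × ι => blk q.1.2) v c GExt
          (fun a a' => (B₀ + B * (kappa385 B₀ (cV385 (Fintype.card κ) α₁ C₀ (M₂ * (∑ i, ‖b i‖) * Real.exp (1 / 5 * δ₀ * d₀))) κ₁
            (kappa383 κQb cFb abar Λ (B6.c1 d δ₀ (1 / 100)) α₁) Λ (B6.c1 d δ₀ (1 / 100)) * α₁) * Λ * B6.c1 d δ₀ (1 / 100)) * g.len a ^ 2 * Real.exp (-(1 / 10 * δ₀ * g.dist a a'))) ∧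
        (∀ k : κ ⊕ κ, HasKernelBound (g := toB6 g Rr H) (fun q : (κ × S) × ι => blk q.1.2) v c
          (conj b (diffLetter (bT T) (bU U) ((g.eta : ℂ)⁻¹) k) * GExt)
          (fun a a' => (B₀ + B * (kappa385 B₀ (cV385 (Fintype.card κ) α₁ C₀ (M₂ * (∑ i, ‖b i‖) * Real.exp (1 / 5 * δ₀ * d₀))) κ₁
            (kappa383 κQb cFb abar Λ (B6.c1 d δ₀ (1 / 100)) α₁) Λ (B6.c1 d δ₀ (1 / 100)) * α₁) * Λ * B6.c1 d δ₀ (1 / 100)) * g.len a * Real.exp (-(1 / 10 * δ₀ * g.dist a a')))) ∧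
        (∀ l : κ ⊕ κ, HasKernelBound (g := toB6 g Rr H) (fun q : (κ × S) × ι => blk q.1.2) v c
          (GExt * conj b (diffLetter (bT T) (bU U) ((g.eta : ℂ)⁻¹) l))
          (fun a a' => (B₀ + B * (kappa385 B₀ (cV385 (Fintype.card κ) α₁ C₀ (M₂ * (∑ i, ‖b i‖) * Real.exp (1 / 5 * δ₀ * d₀))) κ₁
            (kappa383 κQb cFb abar Λ (B6.c1 d δ₀ (1 / 100)) α₁) Λ (B6.c1 d δ₀ (1 / 100)) * α₁) * Λ * B6.c1 d δ₀ (1 / 100)) * g.len a * Real.exp (-(1 / 10 * δ₀ * g.dist a a')))) ∧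
        (∀ k l : κ ⊕ κ, HasKernelBound (g := toB6 g Rr H) (fun q : (κ × S) × ι => blk q.1.2) v c
          (conj b (diffLetter (bT T) (bU U) ((g.eta : ℂ)⁻¹) k) * GExt * conj b (diffLetter (bT T) (bU U) ((g.eta : ℂ)⁻¹) l))
          (fun a a' => (B₀ + B * (kappa385 B₀ (cV385 (Fintype.card κ) α₁ C₀ (M₂ * (∑ i, ‖b i‖) * Real.exp (1 / 5 * δ₀ * d₀))) κ₁
            (kappa383 κQb cFb abar Λ (B6.c1 d δ₀ (1 / 100)) α₁) Λ (B6.c1 d δ₀ (1 / 100)) * α₁) * Λ * B6.c1 d δ₀ (1 / 100)) * Real.exp (-(1 / 10 * δ₀ * g.dist a a'))))) := by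
  classical
  obtain ⟨a₁, ha₁, B, hB, Hmain⟩ := thm34_G_clause_final_blk (Rr := Rr) (H := H) b T U blk d δ₀ B₀ κQ BG B₁ cF Cq a₀ C₀ d₀ M₂ κQb cFb abar kQ sQ
    cfun w hB₀ hκQ hBG hB₁ hcF hCq ha₀ hC₀ hM₂ hδ₀ hκQb hcFb habar hdnn htri hrefl hsym hlen hlenη hη hL h261 hST hrepr hT hU1 h35 hd₀B hd₀F
    hd₀FB hd₀st hd₀loc hd₀0 hw hcard hkQ hsQ hcfun h342_1 h342_2 h342_3 blkP rep hrep hinj hQc hQcs hLinv h348 hQb hQsb ha324 hΔG hGΔ hG hDG hGD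
  obtain ⟨Λ, hΛ, hT1, hT2, hT1i, hT2i, -, -⟩ := hST (1 / 100) (by norm_num)
  refine ⟨min a₁ (1 / 4), lt_min ha₁ (by norm_num), B, hB, Λ, hΛ, ?_⟩
  intro α₁ hα₁0 hα₁1 A kF sF hkF hsF h337B h337F h337B' h337Bτ h337FB hA hAτB hAτF hAFB hAst hAloc hdAst Qc' Fc Qcs' Fcs h357
    h357s hFc hFcs P₂ Qs' Q' F₂ F₂s h380 h380s hP₂def hF₂ hF₂s
  have hα₁a : α₁ ≤ a₁ := hα₁1.trans (min_le_left _ _)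
  have hα₁q : α₁ ≤ 1 / 4 := hα₁1.trans (min_le_right _ _)
  obtain ⟨Tinv, GExt, e1, e2, e3, e4, hLeft, hRight⟩ := Hmain α₁ hα₁0 hα₁a A kF sF hkF hsF h337B h337F h337B' h337Bτ h337FB hA hAτB
    hAτF hAFB hAst hAloc hdAst h357 h357s hFc hFcs h380 h380s hP₂def hF₂ hF₂s
  refine ⟨Tinv, GExt, e1, e2, e3, e4, hLeft, hRight, ?_⟩
  intro κ₁ hκ₁ hP₁
  -- constants and their signs
  have hΛ0 : 0 ≤ Λ := zero_le_one.trans hΛ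
  have hSb : 0 ≤ ∑ i, ‖b i‖ := Finset.sum_nonneg fun i _ => norm_nonneg _
  have hc₁ : 0 ≤ B6.c1 d δ₀ (1 / 100) := B6RandomWalk.c1_nonneg d δ₀ (1 / 100)
  have h261β : Ineq261 d (toB6 g Rr H) δ₀ (1 / 100) := h261 (1 / 100) (by norm_num) (by norm_num)
  have hκ₂0 : 0 ≤ kappa383 κQb cFb abar Λ (B6.c1 d δ₀ (1 / 100)) α₁ := kappa383_nonneg hκQb hcFb habar hΛ0 hc₁ hα₁0
  have hw1 : ∀ a : g.Site, 0 ≤ g.len a := fun a => (hlen a).le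
  have hw2 : ∀ a : g.Site, 0 ≤ g.len a ^ 2 := fun a => sq_nonneg _
  have hw1i : ∀ a : g.Site, 0 ≤ (g.len a)⁻¹ := fun a => inv_nonneg.mpr (hlen a).le
  have hδ5 : 1 / 5 * δ₀ ≤ δ₀ := by linarith only [hδ₀]
  -- `η·α₁(Lʲη)⁻¹ ≦ 1/4` from `α₁ ≦ 1/4` and `η ≦ Lʲη`
  have hsmall : ∀ y : g.Site, g.eta * (α₁ * (g.len y)⁻¹) ≤ 1 / 4 := fun y => by
    have hq : g.eta * (g.len y)⁻¹ ≤ 1 := by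
      rw [← div_eq_mul_inv]; exact (div_le_one (hlen y)).mpr (hlenη y)
    calc g.eta * (α₁ * (g.len y)⁻¹) = α₁ * (g.eta * (g.len y)⁻¹) := by ring
      _ ≤ α₁ * 1 := mul_le_mul_of_nonneg_left hq hα₁0
      _ ≤ 1 / 4 := by linarith only [hα₁q]
  -- `P₂`'s (3.83) from the (3.15)/(3.80)–(3.81) letters (`B9Ineq385VG.ineq383_op`), at the rate `δ₀/5`
  have hP₂ : HasMajorant (g := toB6 g Rr H) (fun q : (κ × S) × ι => blk q.1.2) P₂
      (fun a a' => kappa383 κQb cFb abar Λ (B6.c1 d δ₀ (1 / 100)) α₁ * α₁ * (g.len a ^ 2)⁻¹ *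
        Real.exp (-(1 / 5 * δ₀ * g.dist a a'))) := by
    rw [hP₂def]
    exact ineq383_op (R := Rr) (H := H) (fun q : (κ × S) × ι => blk q.1.2) d δ₀ δ₀ (1 / 100) (1 / 100) (1 / 5 * δ₀) Λ κQb cFb
      abar α₁ hκQb hcFb habar hα₁0 hΛ0 (by linarith only [hδ₀]) (by norm_num) (by norm_num) hδ₀.le (by linarith only [hδ₀]) hdnn htri
      h261β hT2i hQb hQsb hF₂ hF₂s ha324
  -- (3.84) for the concrete operators and the resolvent form of (3.86)
  have h371 := conj_lapDDLetter_prodCfg (b := b) (T := T) (U := U) hη.ne' A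
  have h376 := eq376_concrete T U b hη.ne' A (Gp ∘ₗ Qcs ∘ₗ Linv ∘ₗ Qc ∘ₗ Gp)
    (B9Eq360Vprime.pPrime Gp (gPrimeExtEnd Gp (conj b (vPrimeConc T U g.eta A blk kQ kF sQ sF cfun) * Gp)) (Qcs ∘ₗ secRes rep) (Qcs' ∘ₗ secRes rep) (secConj rep Linv) (secConj rep Tinv) (secExt rep ∘ₗ Qc) (secExt rep ∘ₗ Qc'))
  have h384 := eq384_sub _ _ (conj b (dPrimeLetter T U g.eta)) (conj b (dPrimeLetter T (prodCfg U g.eta A) g.eta)) _ _ Qs Qs' Q Q' a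
    (conj b (V₁Op T U g.eta A)) (conj b (V₂Op T U g.eta A)) _ F₂ F₂s h371 h376 h380 h380s
  rw [← conj_V₃Op_eq_vThree, ← hP₂def] at h384
  have h386 := eq386_resolvent_of_inverses hΔG e4 h384
  have hθ : 0 ≤ (kappa385 B₀ (cV385 (Fintype.card κ) α₁ C₀ (M₂ * (∑ i, ‖b i‖) * Real.exp (1 / 5 * δ₀ * d₀))) κ₁ (kappa383 κQb cFb abar Λ (B6.c1 d δ₀ (1 / 100)) α₁) Λ (B6.c1 d δ₀ (1 / 100)) * α₁) :=
    mul_nonneg (kappa385_nonneg hB₀ (cV385_nonneg (Fintype.card κ) hα₁0 hC₀ (by positivity)) hκ₁ hκ₂0 hΛ0 hc₁) hα₁0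
  -- scale transfers for the weights `(Lʲη)²·(Lʲη)⁻¹ = Lʲη`, `Lʲη·(Lʲη)⁻¹ = 1`, and the constant weight
  have hT2' : ScaleTransfer g δ₀ (1 / 100) Λ (fun a => g.len a ^ 2 * (g.len a)⁻¹) := by
    have e : (fun a : g.Site => g.len a ^ 2 * (g.len a)⁻¹) = fun a => g.len a := by
      funext a; have ha : g.len a ≠ 0 := (hlen a).ne'; field_simp
    rw [e]; exact hT1
  have hSTc : ∀ C : ℝ, 1 ≤ C → ScaleTransfer g δ₀ (1 / 100) C (fun _ : g.Site => (1 : ℝ)) := fun C hC y y' => by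
    rw [mul_one, mul_one]
    exact (Real.exp_le_one_iff.mpr (by nlinarith [hdnn y y', hδ₀])).trans hC
  have hT1' : ScaleTransfer g δ₀ (1 / 100) Λ (fun a => g.len a * (g.len a)⁻¹) := by
    have e : (fun a : g.Site => g.len a * (g.len a)⁻¹) = fun _ => (1 : ℝ) := by
      funext a; exact mul_inv_cancel₀ (hlen a).ne'
    rw [e]; exact hSTc Λ hΛ
  -- (3.85) with the kernel bound on the right letter `Tr = G(U)` (weight `(Lʲη)²`)
  have hGk5 := hasKernelBound_rate_mono (R := Rr) (H := H) (fun q : (κ × S) × ι => blk q.1.2) hv c B₀ (fun a => g.len a ^ 2) hB₀ hw2 hδ5 hdnn hGk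
  have hDGk5 : ∀ k : κ ⊕ κ, HasKernelBound (g := toB6 g Rr H) (fun q : (κ × S) × ι => blk q.1.2) v c (conj b (diffLetter (bT T) (bU U) ((g.eta : ℂ)⁻¹) k) * G)
      (fun a a' => B₀ * (g.len a ^ 2 * (g.len a)⁻¹) * Real.exp (-(1 / 5 * δ₀ * g.dist a a'))) := by
    intro k
    have h := hasKernelBound_rate_mono (R := Rr) (H := H) (fun q : (κ × S) × ι => blk q.1.2) hv c B₀ (fun a => g.len a) hB₀ hw1 hδ5 hdnn (hDGk k)
    refine hasKernelBound_mono (g := toB6 g Rr H) _ hv h fun a a' => le_of_eq ?_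
    have ha : g.len a ≠ 0 := (hlen a).ne'
    field_simp
  have h385k := ineq385_kernel_concreteV₃ (Rr := Rr) (H := H) b T U blk d δ₀ (1 / 5 * δ₀) (1 / 100) (1 / 100) (1 / 10 * δ₀) Λ B₀ κ₁
    (kappa383 κQb cFb abar Λ (B6.c1 d δ₀ (1 / 100)) α₁) α₁ C₀ d₀ M₂ (fun a => g.len a ^ 2) hB₀ hκ₁ hκ₂0 hα₁0 hC₀ hΛ0
    (by linarith only [hδ₀]) (by norm_num) (by norm_num) hδ₀.le (by linarith only [hδ₀]) hM₂ (by linarith only [hδ₀]) hw2 hdnn htri hlen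
    h261β hT2 hT2' hrepr hη hL A hsmall hU1 h337B h337F h337B' hA hAτB hAτF hAst hAloc hdAst h35 hd₀B hd₀F hd₀FB hd₀st hd₀loc hd₀0
    hv hc hP₁ hP₂ hGk5 hDGk5
  have h385k' : HasKernelBound (g := toB6 g Rr H) (fun q : (κ × S) × ι => blk q.1.2) v c
      (vTotal (conj b (V₃Op T U g.eta A)) ((conjHom b (gradLin T ((g.eta : ℂ)⁻¹) (prodCfg U g.eta A)) - conjHom b (gradLin T ((g.eta : ℂ)⁻¹) U)) ∘ₗ (Gp ∘ₗ Qcs ∘ₗ Linv ∘ₗ Qc ∘ₗ Gp) ∘ₗ conjHom b (divLin T ((g.eta : ℂ)⁻¹) U) + conjHom b (gradLin T ((g.eta : ℂ)⁻¹) U) ∘ₗ (Gp ∘ₗ Qcs ∘ₗ Linv ∘ₗ Qc ∘ₗ Gp) ∘ₗ (conjHom b (divLin T ((g.eta : ℂ)⁻¹) (prodCfg U g.eta A)) - conjHom b (divLin T ((g.eta : ℂ)⁻¹) U)) + (conjHom b (gradLin T ((g.eta : ℂ)⁻¹) (prodCfg U g.eta A)) - conjHom b (gradLin T ((g.eta :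 ℂ)⁻¹) U)) ∘ₗ (Gp ∘ₗ Qcs ∘ₗ Linv ∘ₗ Qc ∘ₗ Gp) ∘ₗ (conjHom b (divLin T ((g.eta : ℂ)⁻¹) (prodCfg U g.eta A)) - conjHom b (divLin T ((g.eta : ℂ)⁻¹) U)) + conjHom b (gradLin T ((g.eta : ℂ)⁻¹) (prodCfg U g.eta A)) ∘ₗ (B9Eq360Vprime.pPrime Gp (gPrimeExtEnd Gp (conj b (vPrimeConc T U g.eta A blk kQ kF sQ sF cfun) * Gp)) (Qcs ∘ₗ secRes rep) (Qcs' ∘ₗ secRes rep) (secConj rep Linv) (secConj rep Tinv) (secExt rep ∘ₗ Qc) (secExt rep ∘ₗ Qc')) ∘ₗ conjHom b (divLin T ((g.eta : ℂ)⁻¹) (prodCfg U g.eta A))) P₂ * G * 1)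
      (fun a a' => (kappa385 B₀ (cV385 (Fintype.card κ) α₁ C₀ (M₂ * (∑ i, ‖b i‖) * Real.exp (1 / 5 * δ₀ * d₀))) κ₁ (kappa383 κQb cFb abar Λ (B6.c1 d δ₀ (1 / 100)) α₁) Λ (B6.c1 d δ₀ (1 / 100)) * α₁) * 1 * Real.exp (-(1 / 10 * δ₀ * g.dist a a'))) := by
    rw [mul_one]
    refine hasKernelBound_mono (g := toB6 g Rr H) _ hv h385k fun a a' => le_of_eq ?_
    have ha : g.len a ≠ 0 := (hlen a).ne'
    field_simp
  -- (3.85) with the kernel bound on the right letter `Tr = G(U)∇*_l` (weight `Lʲη`)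
  have h385kR : ∀ l : κ ⊕ κ, HasKernelBound (g := toB6 g Rr H) (fun q : (κ × S) × ι => blk q.1.2) v c
      (vTotal (conj b (V₃Op T U g.eta A)) ((conjHom b (gradLin T ((g.eta : ℂ)⁻¹) (prodCfg U g.eta A)) - conjHom b (gradLin T ((g.eta : ℂ)⁻¹) U)) ∘ₗ (Gp ∘ₗ Qcs ∘ₗ Linv ∘ₗ Qc ∘ₗ Gp) ∘ₗ conjHom b (divLin T ((g.eta : ℂ)⁻¹) U) + conjHom b (gradLin T ((g.eta : ℂ)⁻¹) U) ∘ₗ (Gp ∘ₗ Qcs ∘ₗ Linv ∘ₗ Qc ∘ₗ Gp) ∘ₗ (conjHom b (divLin T ((g.eta : ℂ)⁻¹) (prodCfg U g.eta A)) - conjHom b (divLin T ((g.eta : ℂ)⁻¹) U)) + (conjHom b (gradLin T ((g.eta : ℂ)⁻¹) (prodCfg U g.eta A)) - conjHom b (gradLin T ((g.eta : ℂ)⁻¹) U)) ∘ₗ (Gp ∘ₗ Qcs ∘ₗ Linv ∘ₗ Qc ∘ₗ Gp) ∘ₗ (conjHom b (divLin T ((g.eta : ℂ)⁻¹) (prodCfg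 U g.eta A)) - conjHom b (divLin T ((g.eta : ℂ)⁻¹) U)) + conjHom b (gradLin T ((g.eta : ℂ)⁻¹) (prodCfg U g.eta A)) ∘ₗ (B9Eq360Vprime.pPrime Gp (gPrimeExtEnd Gp (conj b (vPrimeConc T U g.eta A blk kQ kF sQ sF cfun) * Gp)) (Qcs ∘ₗ secRes rep) (Qcs' ∘ₗ secRes rep) (secConj rep Linv) (secConj rep Tinv) (secExt rep ∘ₗ Qc) (secExt rep ∘ₗ Qc')) ∘ₗ conjHom b (divLin T ((g.eta : ℂ)⁻¹) (prodCfg U g.eta A))) P₂ * G * conj b (diffLetter (bT T) (bU U) ((g.eta : ℂ)⁻¹) l))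
      (fun a a' => (kappa385 B₀ (cV385 (Fintype.card κ) α₁ C₀ (M₂ * (∑ i, ‖b i‖) * Real.exp (1 / 5 * δ₀ * d₀))) κ₁ (kappa383 κQb cFb abar Λ (B6.c1 d δ₀ (1 / 100)) α₁) Λ (B6.c1 d δ₀ (1 / 100)) * α₁) * (g.len a)⁻¹ * Real.exp (-(1 / 10 * δ₀ * g.dist a a'))) := by
    intro l
    have hTr := hasKernelBound_rate_mono (R := Rr) (H := H) (fun q : (κ × S) × ι => blk q.1.2) hv c B₀ (fun a => g.len a) hB₀ hw1 hδ5 hdnn (hGDk l)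
    have hDTr : ∀ k : κ ⊕ κ, HasKernelBound (g := toB6 g Rr H) (fun q : (κ × S) × ι => blk q.1.2) v c (conj b (diffLetter (bT T) (bU U) ((g.eta : ℂ)⁻¹) k) * (G * conj b (diffLetter (bT T) (bU U) ((g.eta : ℂ)⁻¹) l)))
        (fun a a' => B₀ * (g.len a * (g.len a)⁻¹) * Real.exp (-(1 / 5 * δ₀ * g.dist a a'))) := by
      intro k
      have h := hasKernelBound_rate_mono (R := Rr) (H := H) (fun q : (κ × S) × ι => blk q.1.2) hv c B₀ (fun _ => (1 : ℝ)) hB₀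
        (fun _ => zero_le_one) hδ5 hdnn
        (show HasKernelBound (g := toB6 g Rr H) (fun q : (κ × S) × ι => blk q.1.2) v c (conj b (diffLetter (bT T) (bU U) ((g.eta : ℂ)⁻¹) k) * (G * conj b (diffLetter (bT T) (bU U) ((g.eta : ℂ)⁻¹) l)))
          (fun a a' => B₀ * (1 : ℝ) * Real.exp (-(δ₀ * g.dist a a'))) by
          rw [← mul_assoc]; simpa only [mul_one] using hDGDk k l)
      refine hasKernelBound_mono (g := toB6 g Rr H) _ hv h fun a a' => le_of_eq ?_
      rw [mul_inv_cancel₀ (hlen a).ne']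
    have h := ineq385_kernel_concreteV₃ (Rr := Rr) (H := H) b T U blk d δ₀ (1 / 5 * δ₀) (1 / 100) (1 / 100) (1 / 10 * δ₀) Λ B₀ κ₁
      (kappa383 κQb cFb abar Λ (B6.c1 d δ₀ (1 / 100)) α₁) α₁ C₀ d₀ M₂ (fun a => g.len a) hB₀ hκ₁ hκ₂0 hα₁0 hC₀ hΛ0
      (by linarith only [hδ₀]) (by norm_num) (by norm_num) hδ₀.le (by linarith only [hδ₀]) hM₂ (by linarith only [hδ₀]) hw1 hdnn htri hlen
      h261β hT1 hT1' hrepr hη hL A hsmall hU1 h337B h337F h337B' hA hAτB hAτF hAst hAloc hdAst h35 hd₀B hd₀F hd₀FB hd₀st hd₀loc hd₀0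
      hv hc hP₁ hP₂ hTr hDTr
    rw [← mul_assoc] at h
    refine hasKernelBound_mono (g := toB6 g Rr H) _ hv h fun a a' => le_of_eq ?_
    have ha : g.len a ≠ 0 := (hlen a).ne'
    field_simp
  -- the majorants of `X·G(U′U)` from FILE 20's universal left clause
  have hGExt1 : HasMajorant (g := toB6 g Rr H) (fun q : (κ × S) × ι => blk q.1.2) (1 * GExt)
      (fun a a' => B * g.len a ^ 2 * Real.exp (-(δ₀ / 6 * g.dist a a'))) :=
    hLeft 1 (fun a => g.len a ^ 2) hw2 (by rw [one_mul]; exact hG)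
  have hGExtD : ∀ k : κ ⊕ κ, HasMajorant (g := toB6 g Rr H) (fun q : (κ × S) × ι => blk q.1.2) (conj b (diffLetter (bT T) (bU U) ((g.eta : ℂ)⁻¹) k) * GExt)
      (fun a a' => B * g.len a * Real.exp (-(δ₀ / 6 * g.dist a a'))) := fun k => hLeft _ (fun a => g.len a) hw1 (hDG k)
  -- the four entries
  have hr10 : 0 ≤ 1 / 10 * δ₀ := by linarith only [hδ₀]
  have hr6 : 1 / 10 * δ₀ + (1 / 100 + 1 / 100) * δ₀ ≤ δ₀ / 6 := by linarith only [hδ₀]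
  have hr1 : 1 / 10 * δ₀ ≤ δ₀ := by linarith only [hδ₀]
  refine ⟨?_, fun k => ?_, fun l => ?_, fun k l => ?_⟩
  · -- (1, 1)
    have h342' : HasKernelBound (g := toB6 g Rr H) (fun q : (κ × S) × ι => blk q.1.2) v c (1 * G * 1)
        (fun a a' => B₀ * (g.len a ^ 2 * 1) * Real.exp (-(δ₀ * g.dist a a'))) := by
      rw [one_mul, mul_one]; simpa only [mul_one] using hGk
    have h := gExt_kernelEntry_of_386 (R := Rr) (H := H) (fun q : (κ × S) × ι => blk q.1.2) d δ₀ (1 / 100) (1 / 100) (1 / 10 * δ₀) δ₀ (δ₀ / 6)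
      Λ B₀ B _ (fun a => g.len a ^ 2) (fun _ => 1) hB₀ hB hθ hw2 (fun _ => zero_le_one) hΛ0 hr10 hr6 hr1 hdnn htri (hSTc Λ hΛ) h261β hv hc
      h386 h342' hGExt1 h385k'
    rw [one_mul, mul_one] at h
    exact hasKernelBound_mono (g := toB6 g Rr H) _ hv h fun a a' => le_of_eq (by ring)
  · -- (∇_k, 1)
    have h342' : HasKernelBound (g := toB6 g Rr H) (fun q : (κ × S) × ι => blk q.1.2) v c (conj b (diffLetter (bT T) (bU U) ((g.eta : ℂ)⁻¹) k) * G * 1)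
        (fun a a' => B₀ * (g.len a * 1) * Real.exp (-(δ₀ * g.dist a a'))) := by
      rw [mul_one]; simpa only [mul_one] using hDGk k
    have h := gExt_kernelEntry_of_386 (R := Rr) (H := H) (fun q : (κ × S) × ι => blk q.1.2) d δ₀ (1 / 100) (1 / 100) (1 / 10 * δ₀) δ₀ (δ₀ / 6)
      Λ B₀ B _ (fun a => g.len a) (fun _ => 1) hB₀ hB hθ hw1 (fun _ => zero_le_one) hΛ0 hr10 hr6 hr1 hdnn htri (hSTc Λ hΛ) h261β hv hc
      h386 h342' (hGExtD k) h385k'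
    rw [mul_one] at h
    exact hasKernelBound_mono (g := toB6 g Rr H) _ hv h fun a a' => le_of_eq (by ring)
  · -- (1, ∇*_l)
    have h342' : HasKernelBound (g := toB6 g Rr H) (fun q : (κ × S) × ι => blk q.1.2) v c (1 * G * conj b (diffLetter (bT T) (bU U) ((g.eta : ℂ)⁻¹) l))
        (fun a a' => B₀ * (g.len a ^ 2 * (g.len a)⁻¹) * Real.exp (-(δ₀ * g.dist a a'))) := by
      rw [one_mul]
      refine hasKernelBound_mono (g := toB6 g Rr H) _ hv (hGDk l) fun a a' => le_of_eq ?_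
      have ha : g.len a ≠ 0 := (hlen a).ne'
      field_simp
    have h := gExt_kernelEntry_of_386 (R := Rr) (H := H) (fun q : (κ × S) × ι => blk q.1.2) d δ₀ (1 / 100) (1 / 100) (1 / 10 * δ₀) δ₀ (δ₀ / 6)
      Λ B₀ B _ (fun a => g.len a ^ 2) (fun a => (g.len a)⁻¹) hB₀ hB hθ hw2 hw1i hΛ0 hr10 hr6 hr1 hdnn htri hT1i h261β hv hc
      h386 h342' hGExt1 (h385kR l)
    rw [one_mul] at h
    refine hasKernelBound_mono (g := toB6 g Rr H) _ hv h fun a a' => le_of_eq ?_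
    have ha : g.len a ≠ 0 := (hlen a).ne'
    field_simp
  · -- (∇_k, ∇*_l)
    have h342' : HasKernelBound (g := toB6 g Rr H) (fun q : (κ × S) × ι => blk q.1.2) v c (conj b (diffLetter (bT T) (bU U) ((g.eta : ℂ)⁻¹) k) * G * conj b (diffLetter (bT T) (bU U) ((g.eta : ℂ)⁻¹) l))
        (fun a a' => B₀ * (g.len a * (g.len a)⁻¹) * Real.exp (-(δ₀ * g.dist a a'))) := by
      refine hasKernelBound_mono (g := toB6 g Rr H) _ hv (hDGDk k l) fun a a' => le_of_eq ?_
      rw [mul_inv_cancel₀ (hlen a).ne', mul_one]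
    have h := gExt_kernelEntry_of_386 (R := Rr) (H := H) (fun q : (κ × S) × ι => blk q.1.2) d δ₀ (1 / 100) (1 / 100) (1 / 10 * δ₀) δ₀ (δ₀ / 6)
      Λ B₀ B _ (fun a => g.len a) (fun a => (g.len a)⁻¹) hB₀ hB hθ hw1 hw1i hΛ0 hr10 hr6 hr1 hdnn htri hT1i h261β hv hc
      h386 h342' (hGExtD k) (h385kR l)
    refine hasKernelBound_mono (g := toB6 g Rr H) _ hv h fun a a' => le_of_eq ?_
    rw [mul_inv_cancel₀ (hlen a).ne', mul_one]

end Kernel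

end Literature.MathematicalPhysics.QuantumFieldTheory.Balaban1983to89.B9Thm34GKernelBlk

end
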